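import Literature.NumberTheory.DiophantineGeometry.StewartYuPadicLogFormsReduction

/-!
# Stewart 2013, Lemma 5 over `ℚ` from the printed Yu–Voutier bound: the cases `2 ≤ n ≤ 5` and `p ≥ 7`

Topic `NumberTheory/DiophantineGeometry`; namespace `Literature.NumberTheory.DiophantineGeometry.Dioph`.

Theorem-only companion of `StewartYuPadicLogFormsReduction.lean` (fourth file of the named fact
`Stewart2013_lemma5_rat`, `StewartYuPadicLogForms.lean`). Throughout, "the printed statement (of
Lemma 5 over `ℚ`)" means the conclusion `ord_p(Ξ − 1) < C h(α₁)⋯h(αₙ) max(log B, (n+1) · 5.4n)`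
exactly as printed — the shape of the named fact until its restatement on 2026-08-15; since then
`Stewart2013_lemma5_rat` is the (3.2)–(3.3) form `max(log B, G₁^ℚ(n))` with Yu's published
`G₁(n,1) = yuG1Rat n` (see the *Restatement record* in `StewartYuPadicLogForms.lean`), and the
theorems below locate exactly how much of the PRINTED form the published argument yields.
Recall the setting (C. L. Stewart, Acta Math. 211 (2013), proof of Lemma 3.1, pp. 301–302 = proof
of Lemma 5, arXiv:1008.1274 p. 8): from Yu's Main Theorem and Voutier's bound Stewart records the
display

  `ord_℘(α₁^{b₁}⋯αₙ^{bₙ} − 1) < C₁ h(α₁)⋯h(αₙ) max(log B, G₁, (n+1) f_℘ log p)`          (P)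

(`C₁ = stewartC1`, `G₁ = stewartG1` for `K = ℚ`, with Stewart's `a₁⁽¹⁾ = a₂⁽¹⁾ = 5.25`; Yu's
published constants for `d = 1` give the same display with `G₁^ℚ = yuG1Rat` (`5.84`) — a formally
WEAKER display, which is the one [Yu2013] provides), and then (17) Stirling, (18) `2^u ≥ 2`,
`f_℘ log p ≥ log 5`, and (19) "`G₁ ≤ (n+1)(5.4n + log d)`". `StewartYuPadicLogFormsReduction.lean`
proves that a display with second term `G ≥ 15(n+1)` gives `C h(α₁)⋯h(αₙ) max(log B, G)` for every
`n ≥ 2` (`Stewart2013_lemma5_rat_maxG_of_printedYuBound`, `…_G1_of_printedYuBound`) and hence the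
printed statement for `n ≥ 6` from (P) (`stewart_G1_le`) and the restated named fact from Yu's
display (`Stewart2013_lemma5_rat_of_yuBound`); for `2 ≤ n ≤ 5` (19) is false (`stewart_G1_gt`).
Here everything is again **proved**, the displays entering only as hypotheses (nothing of Yu's
theorem is proved), and the residue of the printed argument is located exactly. From Stewart's
display (P) (`stewartG1`, `5.25`):

* `stewartG1_le_three_halves`, `stewartG1_le_d146` — `G₁ ≤ (3/2)(n+1) · 5.4n` and indeed
  `G₁ ≤ 1.46 (n+1) · 5.4n` for `n ≥ 2` (the defect of (19) is largest at `n = 2`: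
  `G₁(2) = 47.15…` against `32.4`);
* `Stewart2013_lemma5_rat_of_printedYuBound_of_G1_le` — for `n ≥ 2`, (P) gives the printed
  statement whenever `log B ≥ G₁(n)`; `Stewart2013_lemma5_rat_three_halves_of_printedYuBound` —
  for every `n ≥ 2`, (P) gives it up to the factor `3/2` (`376 ↦ 564`);
* `stewartC1_le` — steps (17)–(18) as the bound
  `C₁ ≤ 972.8 (n+1)^{1/2} (7e(p−1)/(p−2))ⁿ max(p δ⁻¹ (n/log p)ⁿ, eⁿ log p) · max(log(e⁴(n+1)), log p)/(log p)²`;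
* `Stewart2013_lemma5_rat_of_printedYuBound_of_seven_le` — **for `p ≥ 7` and every `n ≥ 2`, (P)
  gives the printed statement exactly** (with the printed `376`): (18) uses only
  `(log p)² ≥ (log 5)²`, and for `p ≥ 7` the slack `376 (log 7)²/972.8 = 1.4635…` exceeds the
  defect `1.46` of (19) (`log_seven_gt_d4`: `1.9458 < log 7`; `stewart_reduction_key₇`);
* `Stewart2013_lemma5_rat_of_printedYuBound_of_not_residual` — **(P) for all `n ≥ 2` gives the
  printed statement whenever `p ≠ 5 ∨ n ≤ 1 ∨ 6 ≤ n ∨ B ≤ 10⁸ ∨ G₁(n) ≤ log B`**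
  (assembling the above with `Stewart2013_lemma5_rat_of_le_one`, `…_of_stewartB_le`,
  `…_of_printedYuBound`).

So, granted (P), the only instances of the printed statement not settled by the printed route
are `p = 5`, `2 ≤ n ≤ 5`, `10⁸ < B < e^{G₁(n)}` (`G₁(5) = 169.2…`), where (19) fails and (18) has
no slack (`376/375.55…`); there (P) still gives the `max(log B, G₁)` form and the statement up to
the factor `3/2`. Stewart's own use of Lemma 5 (proof of his Lemma 8, with
`n = k = [log p/(51.8 log log p)] ≥ 2`, so `p` large) lies inside `p ≥ 7`.

From Yu's PUBLISHED display (second term `G₁^ℚ = yuG1Rat`, `a₁⁽¹⁾ = a₂⁽¹⁾ = 5.84`, the hypothesis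
`H` of `Stewart2013_lemma5_rat_of_yuBound`; its defect against (19) is `G₁^ℚ(2)/32.4 = 1.514…`,
and `G₁^ℚ(n) ≤ (n+1) · 5.4n` only from `n = 7` on, `yuG1Rat_le_printed`):

* `yuG1Rat_le_d153`, `yuG1Rat_le_d13` — `G₁^ℚ ≤ 1.53 (n+1) · 5.4n` for `n ≥ 2` and
  `G₁^ℚ ≤ 1.3 (n+1) · 5.4n` for `n ≥ 3`;
* `stewart_reduction_key_gen`, `Stewart2013_lemma5_rat_printed_of_display_of_ratio` — steps
  (17)–(18) with an abstract second term `G ≤ r (n+1) · 5.4n`, `1 ≤ r ≤ 2`,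
  `972.8 r ≤ 376 (log p)²`: the display gives the printed statement;
* `Stewart2013_lemma5_rat_printed_of_yuBound_of_eleven_le` — **for `p ≥ 11` and every `n ≥ 2`,
  Yu's published display gives the printed statement exactly** (`376 (log 8)²/972.8 > 1.53`);
  `Stewart2013_lemma5_rat_printed_of_yuBound_of_seven_le_of_three_le` — the same for `p ≥ 7`,
  `n ≥ 3` (`376 (log 7)²/972.8 = 1.4635… > 1.3`);
* `Stewart2013_lemma5_rat_printed_of_yuBound_of_not_residual` — **Yu's published display for all
  `n ≥ 2` gives the printed statement whenever
  `11 ≤ p ∨ (7 ≤ p ∧ 3 ≤ n) ∨ n ≤ 1 ∨ B ≤ 10⁸ ∨ G₁^ℚ(n) ≤ log B`**;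
  `Stewart2013_lemma5_rat_printed_of_yuBound_outside_corner` adds the case `7 ≤ n` (all `p`; step
  (19) with Yu's constants, via the restated fact), and `stewart_corner_iff` identifies the
  complement as `(p = 5 ∧ 2 ≤ n ≤ 6) ∨ (p = 7 ∧ n = 2)`.

So, granted Yu's Theorem I over `ℚ` as published (and step (19) for Yu's constants from `n = 7`
on, `StewartYuPadicLogFormsReduction.lean`), the printed Lemma 5 over `ℚ` is established except
for `(p = 5, 2 ≤ n ≤ 6)` and `(p = 7, n = 2)` with `10⁸ < B < e^{G₁^ℚ(n)}` — the corner named in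
the *Restatement record* of `StewartYuPadicLogForms.lean`, now backed by these theorems.

Finally (§U), the uniform shape in which the lemma is used downstream: Yu. Bilu, S. Gun and
H. Hong, *Uniform explicit Stewart theorem on prime factors of linear recurrences*, Acta Arith. 206
(2022), 223–243 (arXiv:2108.09857), Theorem 3.1 — "a simplification (with slightly bigger numerical
constants) of [St13]": `ν_𝔭(⋯) ≤ 10⁵ d^{k+2}(log⁺d)³ · 30^k k^{5/2} log⁺k · h(α₁)⋯h(α_k) · Ω · log⁺B`
— is derived **over `ℚ`** from the named fact (`Stewart2013_lemma5_rat.uniform`,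
`Stewart2013_lemma5_rat.uniform_delta_one`), and unconditionally for `k ≤ 1`
(`Stewart2013_lemma5_rat_uniform_of_le_one`), by the arithmetic printed there
(`bhg_uniform_engine`: `√(k+1) ≤ √2 √k`, `7e(p−1)/(p−2) ≤ 30`, `log(e⁴(k+1)) ≤ 8 log⁺k`,
`max{log B, G} ≤ 13k² log⁺B`, `376 · 104 √2 < 10⁵`), with Yu's `G₁(k,1) ≤ 13k²` (`k ≥ 2`,
`yuG1Rat_le_thirteen_sq`) in place of the printed `(k+1) · 5.4k ≤ 13k²`: the restatement of the
named fact costs this downstream form nothing. (Their Kummer clause for `δ` is printed without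
`ζ^{1/2}`; the theorem is vendored with Stewart's `δ`, from which it is quoted and proved — see the
docstring of `Stewart2013_lemma5_rat.uniform`.)

And (§Y) **Yu's own Lemma 9.3 over `ℚ`** [Yu2013, Lemma 9.3, p. 378]: for
`B ≥ max{|bᵢ|, 5}`, `ord_p(Ξ − 1) < C₄ h₀(α₁)⋯h₀(αₙ) log B` with `C₄(n,1,p,a) = (n+1) · C`
(`yuC4Rat_eq`; "generally speaking sharper than [25, Lemma 3.1]": no `max` with `G₁`, at the price
of the factor `n+1` — so it does NOT give back the printed `max(log B, (n+1) · 5.4n)` in the corner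
`B > 10⁸` of the *Restatement record*), derived from the named fact for every `n ≥ 1`
(`Stewart2013_lemma5_rat.yu2013_lemma9_3`) and unconditionally for `n = 1`
(`yu2013_lemma9_3_rat_one`) by the Liouville dichotomy of [Yu2013, Lemma 8.1] made explicit over
`ℚ` (`yu_lemma9_3_engine`: if `G₁^ℚ(n) ≤ (n+1) log B` the fact suffices; otherwise
`B < e^{a₀n + a₁}(a₀n + a₁)` and the Liouville bound wins, the product of the other `n − 1` heights
being `≥ log 2 ⋯ log n` because `m` multiplicatively independent rationals involve `≥ m` primes —
`le_card_primeSupport`, `prod_log_le_prod_logHeight₁`, an elementary substitute over `ℚ` for the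
Loher–Masser bound [14, Theorem 3] used there; numerics `yu93_numeric`).

## References

* [Stewart2013] C. L. Stewart, *On divisors of Lucas and Lehmer numbers*, Acta Math. 211 (2013),
  291–314 (arXiv:1008.1274), §3, proof of Lemma 5, displays (17)–(19) (p. 8); proof of Lemma 8.
* [Yu2013] K. Yu, *p-adic logarithmic forms and a problem of Erdős*, Acta Math. 211 (2013),
  315–382, Main Theorem (1.18) with (1.9), (1.11), (1.13); §1.3 (1.28)–(1.31), case (III.2).
* [BiluGunHong2022] Yu. Bilu, S. Gun, H. Hong, *Uniform explicit Stewart theorem on prime factors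
  of linear recurrences*, Acta Arith. 206 (2022), 223–243 (arXiv:2108.09857): §3, Theorem 3.1 and
  its proof (p. 5 of the arXiv version); §4 (application with `δ = 1`).
* [Yu2013] for §Y: Theorem 1 (1.19)–(1.24) p. 323; §8, Lemma 8.1 and its proof, (8.1)–(8.5)
  pp. 369–370; §9, Lemma 9.3 with `C₄`, (9.14)–(9.15), pp. 377–378 (read on the journal pages).
-/

open Height Real Finset

noncomputable section

namespace Literature.NumberTheory.DiophantineGeometry.Dioph

/-! ### What (P) gives for `2 ≤ n ≤ 5`: the exact statement when `log B ≥ G₁`, and a factor `3/2` in general -/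

/-- `log 13.15 < 2.6` (`13.15^5 < e^{13}`). [folklore] -/
theorem log_d1315_lt : Real.log 13.15 < 2.6 := by
  rw [Real.log_lt_iff_lt_exp (by norm_num)]
  have h5 : Real.exp 2.6 ^ 5 = Real.exp 13 := by rw [← Real.exp_nat_mul]; norm_num
  have h13 : (13.15 : ℝ) ^ 5 < Real.exp 13 := by
    calc (13.15 : ℝ) ^ 5 < 2.7182818283 ^ 13 := by norm_num
      _ < Real.exp 1 ^ 13 := by gcongr; exact Real.exp_one_gt_d9
      _ = Real.exp 13 := by rw [Real.exp_one_pow]; norm_num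
  have h : (13.15 : ℝ) ^ 5 < Real.exp 2.6 ^ 5 := by rw [h5]; exact h13
  exact lt_of_pow_lt_pow_left₀ 5 (Real.exp_pos _).le h

/-- **`G₁ ≤ (3/2) · (n+1) · 5.4 n` for `n ≥ 2`** (`= (n+1) · 8.1 n`; at `n = 2`: `47.15… ≤ 48.6`): the
printed step (19) fails for `2 ≤ n ≤ 5` (`stewart_G1_gt`) but only by a factor `< 3/2`.
[cite: Stewart2013, proof of Lemma 5 ((19))] -/
theorem stewartG1_le_three_halves {n : ℕ} (hn : 2 ≤ n) :
    stewartG1 n ≤ 3 / 2 * (((n : ℝ) + 1) * (5.4 * n)) := by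
  rw [stewartG1_def]
  have hn0 : (0 : ℝ) ≤ n + 1 := by positivity
  have hnR : (2 : ℝ) ≤ n := by exact_mod_cast hn
  have ha : (1.9 : ℝ) < Real.log 7 := log_seven_gt_d1
  have hb : Real.log 7 < 1.95 := log_seven_lt_d2
  set x := (2 + Real.log 7) * n + 5.25 with hx
  have hxlo : 3.9 * (n : ℝ) + 5.25 < x := by rw [hx]; nlinarith
  have hxup : x < 3.95 * (n : ℝ) + 5.25 := by rw [hx]; nlinarith
  have hx0 : (0 : ℝ) < x := by linarith
  have hlogx : Real.log x ≤ Real.log 13.15 + (x / 13.15 - 1) := by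
    have hsplit : Real.log x = Real.log 13.15 + Real.log (x / 13.15) := by
      rw [← Real.log_mul (by norm_num) (by positivity)]
      congr 1
      field_simp
    rw [hsplit]
    have := Real.log_le_sub_one_of_pos (show 0 < x / 13.15 by positivity)
    linarith
  have h1315 := log_d1315_lt
  have hdiv : x / 13.15 < (3.95 * (n : ℝ) + 5.25) / 13.15 := by gcongr
  have hfin : x + Real.log x < 3.95 * n + 5.25 + 2.6 + ((3.95 * n + 5.25) / 13.15 - 1) := by
    linarith
  have hkey : 3.95 * (n : ℝ) + 5.25 + 2.6 + ((3.95 * n + 5.25) / 13.15 - 1) ≤ 8.1 * n := by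
    field_simp
    nlinarith
  calc ((n : ℝ) + 1) * (x + Real.log x) ≤ ((n : ℝ) + 1) * (8.1 * n) :=
        mul_le_mul_of_nonneg_left (by linarith) hn0
    _ = 3 / 2 * (((n : ℝ) + 1) * (5.4 * n)) := by ring

/-- **For `2 ≤ n` (in particular `2 ≤ n ≤ 5`), (P) gives the printed statement of Lemma 5 over `ℚ`
whenever `log B ≥ G₁`** (then `max(log B, G₁) = log B`): combined with
`Stewart2013_lemma5_rat_of_printedYuBound` (`n ≤ 1 ∨ 6 ≤ n`) and
`Stewart2013_lemma5_rat_of_stewartB_le` (`B ≤ 10⁸`), the only range of the printed statement NOT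
covered by the printed argument from (P) is `2 ≤ n ≤ 5`, `10⁸ < B < e^{G₁(n)}` (and `p = 5`, see
`Stewart2013_lemma5_rat_of_printedYuBound_of_seven_le`).
[cite: Stewart2013, proof of Lemma 5, (17)–(19)] -/
theorem Stewart2013_lemma5_rat_of_printedYuBound_of_G1_le (n p : ℕ) (α : Fin n → ℚ)
    (b : Fin n → ℤ) (hn : 2 ≤ n) (hp5 : 5 ≤ p) (hα0 : ∀ i, α i ≠ 0)
    (hind : ∀ e : Fin n → ℤ, ∏ i, α i ^ e i = 1 → e = 0)
    (hYu : (padicValRat p (∏ i, α i ^ b i - 1) : ℝ) <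
      stewartC1 n p (stewartDelta p α) * (∏ i, logHeight₁ (α i)) *
        max (Real.log (stewartB b)) (max (stewartG1 n) ((n + 1) * Real.log p)))
    (hG : stewartG1 n ≤ Real.log (stewartB b)) :
    (padicValRat p (∏ i, α i ^ b i - 1) : ℝ) <
      stewartC n p (stewartDelta p α) * (∏ i, logHeight₁ (α i)) *
        max (Real.log (stewartB b)) ((n + 1) * (5.4 * n)) := by
  have h1 := Stewart2013_lemma5_rat_G1_of_printedYuBound n p α b hn hp5 hα0 hind hYu
  rw [max_eq_left hG] at h1
  have hC0 : 0 ≤ stewartC n p (stewartDelta p α) :=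
    le_trans (by
      have hL : 0 ≤ Real.log p := Real.log_natCast_nonneg p
      positivity) (stewartC_ge n hp5 (stewartDelta p α))
  have hP0 : 0 ≤ ∏ i, logHeight₁ (α i) := Finset.prod_nonneg fun i _ => zero_le_logHeight₁ _
  exact lt_of_lt_of_le h1 (mul_le_mul_of_nonneg_left (le_max_left _ _) (mul_nonneg hC0 hP0))

/-- **For every `n ≥ 2`, (P) gives the printed statement of Lemma 5 over `ℚ` up to a factor `3/2`** (i.e.
with `376` replaced by `564` in `C`): `ord_p(Ξ − 1) < (3/2) · C h(α₁)⋯h(αₙ) max(log B, (n+1) · 5.4n)`,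
because `max(log B, G₁) ≤ (3/2) max(log B, (n+1) · 5.4n)` (`stewartG1_le_three_halves`, `log B ≥ 0`).
This quantifies the caveat on the printed step (19) for `2 ≤ n ≤ 5`: as printed, the derivation
from Yu's Main Theorem loses at most the factor `3/2` in the constant.
[cite: Stewart2013, Lemma 5 and its proof, (17)–(19)] -/
theorem Stewart2013_lemma5_rat_three_halves_of_printedYuBound (n p : ℕ) (α : Fin n → ℚ)
    (b : Fin n → ℤ) (hn : 2 ≤ n) (hp5 : 5 ≤ p) (hα0 : ∀ i, α i ≠ 0)
    (hind : ∀ e : Fin n → ℤ, ∏ i, α i ^ e i = 1 → e = 0)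
    (hYu : (padicValRat p (∏ i, α i ^ b i - 1) : ℝ) <
      stewartC1 n p (stewartDelta p α) * (∏ i, logHeight₁ (α i)) *
        max (Real.log (stewartB b)) (max (stewartG1 n) ((n + 1) * Real.log p))) :
    (padicValRat p (∏ i, α i ^ b i - 1) : ℝ) <
      3 / 2 * (stewartC n p (stewartDelta p α) * (∏ i, logHeight₁ (α i)) *
        max (Real.log (stewartB b)) ((n + 1) * (5.4 * n))) := by
  have h1 := Stewart2013_lemma5_rat_G1_of_printedYuBound n p α b hn hp5 hα0 hind hYu
  have hB : 0 ≤ Real.log (stewartB b) := by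
    apply Real.log_nonneg
    exact_mod_cast le_trans (by norm_num) (two_le_stewartB b)
  have hmax : max (Real.log (stewartB b)) (stewartG1 n) ≤
      3 / 2 * max (Real.log (stewartB b)) (((n : ℝ) + 1) * (5.4 * n)) := by
    apply max_le
    · linarith [le_max_left (Real.log (stewartB b)) (((n : ℝ) + 1) * (5.4 * n))]
    · exact le_trans (stewartG1_le_three_halves hn)
        (mul_le_mul_of_nonneg_left (le_max_right _ _) (by norm_num))
  have hC0 : 0 ≤ stewartC n p (stewartDelta p α) :=
    le_trans (by
      have hL : 0 ≤ Real.log p := Real.log_natCast_nonneg p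
      positivity) (stewartC_ge n hp5 (stewartDelta p α))
  have hP0 : 0 ≤ ∏ i, logHeight₁ (α i) := Finset.prod_nonneg fun i _ => zero_le_logHeight₁ _
  calc (padicValRat p (∏ i, α i ^ b i - 1) : ℝ)
      < stewartC n p (stewartDelta p α) * (∏ i, logHeight₁ (α i)) *
          max (Real.log (stewartB b)) (stewartG1 n) := h1
    _ ≤ stewartC n p (stewartDelta p α) * (∏ i, logHeight₁ (α i)) *
          (3 / 2 * max (Real.log (stewartB b)) (((n : ℝ) + 1) * (5.4 * n))) :=
        mul_le_mul_of_nonneg_left hmax (mul_nonneg hC0 hP0)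
    _ = _ := by ring

/-! ### `p ≥ 7`: the slack of (18) (`972.8 ≤ 376 (log p)²`, tight only at `p = 5`) absorbs `G₁` for every `n ≥ 2` -/

/-- `1.9458 < log 7` (`2 log 7 = 4 log 2 + log 3 + log(49/48)` and `log(49/48) ≥ 1 − 48/49`).
[folklore] -/
theorem log_seven_gt_d4 : (1.9458 : ℝ) < Real.log 7 := by
  have h2 := Real.log_two_gt_d9
  have h3 := Real.log_three_gt_d9
  have h49 : (1 : ℝ) - (49 / 48)⁻¹ ≤ Real.log (49 / 48) :=
    Real.one_sub_inv_le_log_of_pos (by norm_num)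
  have hlog49 : Real.log 49 = 2 * Real.log 7 := by
    rw [show (49 : ℝ) = 7 ^ 2 by norm_num, Real.log_pow]; norm_num
  have hsplit : Real.log 49 = 4 * Real.log 2 + Real.log 3 + Real.log (49 / 48) := by
    rw [show (49 : ℝ) = 2 ^ 4 * 3 * (49 / 48) by norm_num, Real.log_mul (by norm_num) (by norm_num),
      Real.log_mul (by norm_num) (by norm_num), Real.log_pow]
    norm_num
  have h48 : (1 : ℝ) - (49 / 48)⁻¹ = 1 / 49 := by norm_num
  linarith

/-- `1.9458 < log p` for `p ≥ 7`. [folklore] -/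
theorem log_gt_of_seven_le {p : ℕ} (hp7 : 7 ≤ p) : (1.9458 : ℝ) < Real.log p :=
  lt_of_lt_of_le log_seven_gt_d4 (Real.log_le_log (by norm_num) (by exact_mod_cast hp7))

/-- **`G₁ ≤ 1.46 · (n+1) · 5.4 n` for `n ≥ 2`** (at `n = 2`: `47.15… ≤ 47.30…`; the ratio
`G₁ / ((n+1) · 5.4 n)` is largest at `n = 2`). [cite: Stewart2013, proof of Lemma 5 ((19))] -/
theorem stewartG1_le_d146 {n : ℕ} (hn : 2 ≤ n) :
    stewartG1 n ≤ 1.46 * (((n : ℝ) + 1) * (5.4 * n)) := by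
  rw [stewartG1_def]
  have hn0 : (0 : ℝ) ≤ n + 1 := by positivity
  have hnR : (2 : ℝ) ≤ n := by exact_mod_cast hn
  have ha : (1.9 : ℝ) < Real.log 7 := log_seven_gt_d1
  have hb : Real.log 7 < 1.95 := log_seven_lt_d2
  set x := (2 + Real.log 7) * n + 5.25 with hx
  have hxlo : 3.9 * (n : ℝ) + 5.25 < x := by rw [hx]; nlinarith
  have hxup : x < 3.95 * (n : ℝ) + 5.25 := by rw [hx]; nlinarith
  have hx0 : (0 : ℝ) < x := by linarith
  have hlogx : Real.log x ≤ Real.log 13.15 + (x / 13.15 - 1) := by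
    have hsplit : Real.log x = Real.log 13.15 + Real.log (x / 13.15) := by
      rw [← Real.log_mul (by norm_num) (by positivity)]
      congr 1
      field_simp
    rw [hsplit]
    have := Real.log_le_sub_one_of_pos (show 0 < x / 13.15 by positivity)
    linarith
  have h1315 := log_d1315_lt
  have hdiv : x / 13.15 < (3.95 * (n : ℝ) + 5.25) / 13.15 := by gcongr
  have hfin : x + Real.log x < 3.95 * n + 5.25 + 2.6 + ((3.95 * n + 5.25) / 13.15 - 1) := by
    linarith
  have hkey : 3.95 * (n : ℝ) + 5.25 + 2.6 + ((3.95 * n + 5.25) / 13.15 - 1) ≤ 7.884 * n := by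
    field_simp
    nlinarith
  calc ((n : ℝ) + 1) * (x + Real.log x) ≤ ((n : ℝ) + 1) * (7.884 * n) :=
        mul_le_mul_of_nonneg_left (by linarith) hn0
    _ = 1.46 * (((n : ℝ) + 1) * (5.4 * n)) := by ring

/-- The key real inequality for `p ≥ 7`: if `L ≥ 1.9458`, `A ≥ 4`, `T ≥ 3`, `M₁ ≤ 1.46 M₂` and
`M₂ ≥ 10 T`, then `972.8 · max(A, L) · max(M₁, T L) ≤ 376 · A · L² · M₂`
(`972.8 · 1.46 = 1420.3 ≤ 376 · 1.9458² = 1423.6`). [folklore] -/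
theorem stewart_reduction_key₇ {L A M₁ M₂ T : ℝ} (hL : 1.9458 ≤ L) (hA : 4 ≤ A) (hT : 3 ≤ T)
    (hM₁ : M₁ ≤ 1.46 * M₂) (hM₂ : 10 * T ≤ M₂) :
    972.8 * max A L * max M₁ (T * L) ≤ 376 * A * L ^ 2 * M₂ := by
  have hL0 : 0 < L := by linarith
  have hA0 : 0 < A := by linarith
  have hT0 : 0 < T := by linarith
  have hM0 : 0 < M₂ := by linarith
  have hL2 : 972.8 * 1.46 ≤ 376 * L ^ 2 := by nlinarith
  rcases le_total L A with hLA | hAL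
  · rw [max_eq_left hLA]
    rcases le_total (T * L) M₁ with h1 | h2
    · rw [max_eq_left h1]
      -- `972.8 A M₁ ≤ 972.8 · 1.46 · A M₂ ≤ 376 L² A M₂`
      have hAM : 0 ≤ A * M₂ := by positivity
      have h3 : 972.8 * A * M₁ ≤ 972.8 * A * (1.46 * M₂) :=
        mul_le_mul_of_nonneg_left hM₁ (by positivity)
      nlinarith [mul_le_mul_of_nonneg_right hL2 hAM]
    · rw [max_eq_right h2]
      -- `972.8 A T L ≤ 376 A L² M₂`, using `M₂ ≥ 10 T` and `L ≥ 1.9458`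
      have h3 : 972.8 * L ≤ 376 * L ^ 2 * 10 := by nlinarith
      have hAT : 0 ≤ A * T := by positivity
      have h4 : 376 * A * L ^ 2 * (10 * T) ≤ 376 * A * L ^ 2 * M₂ :=
        mul_le_mul_of_nonneg_left hM₂ (by positivity)
      nlinarith [mul_le_mul_of_nonneg_right h3 hAT]
  · rw [max_eq_right hAL]
    rcases le_total (T * L) M₁ with h1 | h2
    · rw [max_eq_left h1]
      -- `972.8 L M₁ ≤ 972.8 · 1.46 · L M₂ ≤ 376 A L² M₂`, using `A L ≥ 4 · 1.9458`
      have h3 : 972.8 * 1.46 ≤ 376 * A * L := by nlinarith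
      have hLM : 0 ≤ L * M₂ := by positivity
      have h4 : 972.8 * L * M₁ ≤ 972.8 * L * (1.46 * M₂) :=
        mul_le_mul_of_nonneg_left hM₁ (by positivity)
      nlinarith [mul_le_mul_of_nonneg_right h3 hLM]
    · rw [max_eq_right h2]
      -- `972.8 L (T L) ≤ 376 A L² M₂`, using `A M₂ ≥ 40 T`
      have h3 : 972.8 * T ≤ 376 * A * (10 * T) := by nlinarith
      have h4 : 376 * A * (10 * T) ≤ 376 * A * M₂ := mul_le_mul_of_nonneg_left hM₂ (by positivity)
      have hLL : 0 ≤ L ^ 2 := by positivity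
      nlinarith [mul_le_mul_of_nonneg_right (h3.trans h4) hLL]

/-- **Steps (17)–(18) of the printed proof as a bound for `C₁` (proved):** for `p ≥ 5`,
`C₁ ≤ 972.8 · (n+1)^{1/2} (7e(p−1)/(p−2))ⁿ max(p δ⁻¹ (n/log p)ⁿ, eⁿ log p) · max(log(e⁴(n+1)), log p)/(log p)²`
(Stirling, `stirling_succ_pow_div_factorial_le`, and `1794 e/(2√(2π)) < 972.8`, `stewart_kappa_lt`).
[cite: Stewart2013, proof of Lemma 5, (17)–(18)] -/
theorem stewartC1_le (n : ℕ) {p : ℕ} (hp5 : 5 ≤ p) (δ : ℝ) :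
    stewartC1 n p δ ≤ 972.8 * (Real.sqrt ((n : ℝ) + 1) *
      (7 * Real.exp 1 * (((p : ℝ) - 1) / ((p : ℝ) - 2))) ^ n *
        max ((p : ℝ) / δ * ((n : ℝ) / Real.log p) ^ n) (Real.exp n * Real.log p)) *
      (max (Real.log (Real.exp 4 * (n + 1))) (Real.log p) / Real.log p ^ 2) := by
  have hp' : (5 : ℝ) ≤ p := by exact_mod_cast hp5
  set L := Real.log p with hLdef
  set A := Real.log (Real.exp 4 * (n + 1)) with hAdef
  set F := ((p : ℝ) - 1) / ((p : ℝ) - 2) with hFdef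
  set MX := max ((p : ℝ) / δ * ((n : ℝ) / L) ^ n) (Real.exp n * L) with hMXdef
  set S := ((n : ℝ) + 1) ^ (n + 1) / (n.factorial : ℝ) with hSdef
  set W := Real.sqrt ((n : ℝ) + 1) * (7 * Real.exp 1 * F) ^ n * MX with hWdef
  have hL : 1.6089 < L := log_gt_d4_of_five_le hp5
  have hL0 : 0 < L := by linarith
  have hE : 0 < Real.exp 1 := Real.exp_pos 1
  have hF1 : 1 ≤ F := by
    rw [hFdef, le_div_iff₀ (by linarith)]; linarith
  have hMX0 : 0 ≤ MX := le_trans (mul_nonneg (Real.exp_pos _).le hL0.le) (le_max_right _ _)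
  have hW0 : 0 ≤ W := by
    rw [hWdef]
    exact mul_nonneg (mul_nonneg (Real.sqrt_nonneg _) (pow_nonneg (by positivity) _)) hMX0
  have hStir : S ≤ Real.exp 1 ^ (n + 1) * Real.sqrt ((n : ℝ) + 1) / Real.sqrt (2 * π) :=
    stirling_succ_pow_div_factorial_le n
  have h2pi : 0 < Real.sqrt (2 * π) := Real.sqrt_pos.mpr (by positivity)
  have hκ : 1794 * Real.exp 1 / (2 * Real.sqrt (2 * π)) < 972.8 := stewart_kappa_lt
  have hmx0 : 0 ≤ max A L := le_trans hL0.le (le_max_right _ _)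
  have hR0 : 0 ≤ 1794 * (7 * F) ^ n * (1 / (2 * L ^ 2)) * MX * max A L := by
    have : 0 ≤ (7 * F) ^ n := pow_nonneg (by linarith) _
    positivity
  calc stewartC1 n p δ = S * (1794 * (7 * F) ^ n * (1 / (2 * L ^ 2)) * MX * max A L) := by
        rw [stewartC1_def]; ring
    _ ≤ (Real.exp 1 ^ (n + 1) * Real.sqrt ((n : ℝ) + 1) / Real.sqrt (2 * π)) *
          (1794 * (7 * F) ^ n * (1 / (2 * L ^ 2)) * MX * max A L) :=
        mul_le_mul_of_nonneg_right hStir hR0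
    _ = (1794 * Real.exp 1 / (2 * Real.sqrt (2 * π))) *
          (Real.sqrt ((n : ℝ) + 1) * ((7 * F) ^ n * Real.exp 1 ^ n) * MX) *
          (max A L / L ^ 2) := by
        field_simp
        ring
    _ = (1794 * Real.exp 1 / (2 * Real.sqrt (2 * π))) * W * (max A L / L ^ 2) := by
        rw [hWdef, ← mul_pow]
        congr 3
        ring
    _ ≤ 972.8 * W * (max A L / L ^ 2) := by
        have : 0 ≤ W * (max A L / L ^ 2) := mul_nonneg hW0 (div_nonneg hmx0 (by positivity))
        nlinarith

/-- **For `p ≥ 7` and every `n ≥ 2`, (P) gives the printed statement of Lemma 5 over `ℚ` exactly**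
(with the printed constant `376`): Stewart's step (18) uses only `(log p)² ≥ (log 5)²`, and for
`p ≥ 7` the resulting slack `376 (log 7)²/972.8 = 1.4635…` exceeds the defect
`G₁/((n+1) · 5.4 n) ≤ 1.46` of the printed step (19) (`stewartG1_le_d146`). So the caveat on
(19) concerns `p = 5` only. Hypotheses as in `Stewart2013_lemma5_rat_G1_of_printedYuBound`
(`hYu` = the printed display (P), NOT proved here). [cite: Stewart2013, proof of Lemma 5, (17)–(19)] -/
theorem Stewart2013_lemma5_rat_of_printedYuBound_of_seven_le (n p : ℕ) (α : Fin n → ℚ)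
    (b : Fin n → ℤ) (hn : 2 ≤ n) (hp7 : 7 ≤ p) (hα0 : ∀ i, α i ≠ 0)
    (hind : ∀ e : Fin n → ℤ, ∏ i, α i ^ e i = 1 → e = 0)
    (hYu : (padicValRat p (∏ i, α i ^ b i - 1) : ℝ) <
      stewartC1 n p (stewartDelta p α) * (∏ i, logHeight₁ (α i)) *
        max (Real.log (stewartB b)) (max (stewartG1 n) ((n + 1) * Real.log p))) :
    (padicValRat p (∏ i, α i ^ b i - 1) : ℝ) <
      stewartC n p (stewartDelta p α) * (∏ i, logHeight₁ (α i)) *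
        max (Real.log (stewartB b)) ((n + 1) * (5.4 * n)) := by
  have hp5 : 5 ≤ p := le_trans (by norm_num) hp7
  have hp' : (7 : ℝ) ≤ p := by exact_mod_cast hp7
  -- names
  set L := Real.log p with hLdef
  set δ := stewartDelta p α with hδdef
  set P := ∏ i, logHeight₁ (α i) with hPdef
  set M₁ := max (Real.log (stewartB b)) (stewartG1 n) with hM₁def
  set M₂ := max (Real.log (stewartB b)) (((n : ℝ) + 1) * (5.4 * n)) with hM₂def
  set A := Real.log (Real.exp 4 * (n + 1)) with hAdef
  set W := Real.sqrt ((n : ℝ) + 1) * (7 * Real.exp 1 * (((p : ℝ) - 1) / ((p : ℝ) - 2))) ^ n *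
    max ((p : ℝ) / δ * ((n : ℝ) / L) ^ n) (Real.exp n * L) with hWdef
  -- basic bounds
  have hL : 1.9458 < L := log_gt_of_seven_le hp7
  have hL0 : 0 < L := by linarith
  have hA : 4 ≤ A := by
    rw [hAdef, Real.log_mul (Real.exp_pos 4).ne' (by positivity), Real.log_exp]
    have : (0 : ℝ) ≤ Real.log (n + 1) :=
      Real.log_nonneg (by have : (0:ℝ) ≤ n := Nat.cast_nonneg n; linarith)
    linarith
  have hnR : (2 : ℝ) ≤ n := by exact_mod_cast hn
  have hT : (3 : ℝ) ≤ (n : ℝ) + 1 := by linarith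
  have hF0 : 0 ≤ ((p : ℝ) - 1) / ((p : ℝ) - 2) := div_nonneg (by linarith) (by linarith)
  have hMX0 : 0 ≤ max ((p : ℝ) / δ * ((n : ℝ) / L) ^ n) (Real.exp n * L) :=
    le_trans (mul_nonneg (Real.exp_pos _).le hL0.le) (le_max_right _ _)
  have hW0 : 0 ≤ W := by
    rw [hWdef]
    exact mul_nonneg (mul_nonneg (Real.sqrt_nonneg _) (pow_nonneg (by positivity) _)) hMX0
  -- heights: `h(αᵢ) ≥ log 2`, so `P > 0`
  have hP0 : 0 < P := by
    rw [hPdef]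
    refine Finset.prod_pos fun i _ => lt_of_lt_of_le ?_
      (log_two_le_logHeight₁ (hα0 i) (ne_one_and_ne_neg_one_of_multIndep hind i).1
        (ne_one_and_ne_neg_one_of_multIndep hind i).2)
    linarith [Real.log_two_gt_d9]
  -- `M₂ ≥ (n+1) 5.4 n ≥ 10 (n+1)` and `M₁ ≤ 1.46 M₂`
  have hS : 10 * ((n : ℝ) + 1) ≤ ((n : ℝ) + 1) * (5.4 * n) := by nlinarith
  have hM₂ : 10 * ((n : ℝ) + 1) ≤ M₂ := le_trans hS (le_max_right _ _)
  have hM₂0 : 0 ≤ M₂ := by linarith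
  have hM₁ : M₁ ≤ 1.46 * M₂ := by
    apply max_le
    · linarith [le_max_left (Real.log (stewartB b)) (((n : ℝ) + 1) * (5.4 * n))]
    · exact le_trans (stewartG1_le_d146 hn)
        (mul_le_mul_of_nonneg_left (le_max_right _ _) (by norm_num))
  have hM3 : max (Real.log (stewartB b)) (max (stewartG1 n) ((n + 1) * L)) =
      max M₁ (((n : ℝ) + 1) * L) := (max_assoc _ _ _).symm
  -- `C₁ ≤ 972.8 · W · max(A, L) / L²` and `C = 376 W A`
  have hC1 : stewartC1 n p δ ≤ 972.8 * W * (max A L / L ^ 2) := stewartC1_le n hp5 δ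
  have hC : stewartC n p δ = 376 * W * A := by
    rw [stewartC_def, hWdef]; ring
  -- the key inequality
  have hkey : 972.8 * max A L * max M₁ (((n : ℝ) + 1) * L) ≤ 376 * A * L ^ 2 * M₂ :=
    stewart_reduction_key₇ hL.le hA hT hM₁ hM₂
  -- assemble
  have hM30 : 0 ≤ max M₁ (((n : ℝ) + 1) * L) :=
    le_trans (by positivity : (0 : ℝ) ≤ ((n : ℝ) + 1) * L) (le_max_right _ _)
  rw [hM3] at hYu
  calc (padicValRat p (∏ i, α i ^ b i - 1) : ℝ)
      < stewartC1 n p δ * P * max M₁ (((n : ℝ) + 1) * L) := hYu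
    _ ≤ 972.8 * W * (max A L / L ^ 2) * P * max M₁ (((n : ℝ) + 1) * L) := by
        apply mul_le_mul_of_nonneg_right _ hM30
        exact mul_le_mul_of_nonneg_right hC1 hP0.le
    _ = (972.8 * max A L * max M₁ (((n : ℝ) + 1) * L)) * (W * P / L ^ 2) := by
        field_simp
    _ ≤ (376 * A * L ^ 2 * M₂) * (W * P / L ^ 2) :=
        mul_le_mul_of_nonneg_right hkey (div_nonneg (mul_nonneg hW0 hP0.le) (by positivity))
    _ = 376 * W * A * P * M₂ := by
        field_simp
    _ = stewartC n p δ * P * M₂ := by rw [hC]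

/-- **Stewart 2013, Lemma 5 over `ℚ` as printed, from the printed bound (P) — everything the printed
argument reaches (proved reduction).** If the display (P) of the printed proof holds for all `n ≥ 2`
(hypothesis `H`, as in `Stewart2013_lemma5_rat_of_printedYuBound`), then the printed statement of
Lemma 5 over `ℚ` (`max(log B, (n+1) · 5.4n)`) holds for `n, p, α, b` whenever
`p ≠ 5 ∨ n ≤ 1 ∨ 6 ≤ n ∨ B ≤ 10⁸ ∨ G₁(n) ≤ log B`
(`…_of_seven_le`, `…_of_le_one`, `…_of_printedYuBound`, `…_of_stewartB_le`, `…_of_G1_le`).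
Equivalently: granted (P), the only instances of the printed statement not settled here are
`p = 5`, `2 ≤ n ≤ 5`, `10⁸ < B < e^{G₁(n)}` (`G₁(2) = 47.15…`, `G₁(5) = 169.2…`), where the printed
step (19) fails (`stewart_G1_gt`) and (18) has no slack. Nothing of (P) is proved here.
[cite: Stewart2013, Lemma 5 and its proof, (17)–(19)] -/
theorem Stewart2013_lemma5_rat_of_printedYuBound_of_not_residual
    (H : ∀ (n p : ℕ) (α : Fin n → ℚ) (b : Fin n → ℤ), 2 ≤ n → p.Prime → 5 ≤ p →
      (∀ i, α i ≠ 0 ∧ padicValRat p (α i) = 0) →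
      (∀ e : Fin n → ℤ, ∏ i, α i ^ e i = 1 → e = 0) → b ≠ 0 →
      (padicValRat p (∏ i, α i ^ b i - 1) : ℝ) <
        stewartC1 n p (stewartDelta p α) * (∏ i, logHeight₁ (α i)) *
          max (Real.log (stewartB b)) (max (stewartG1 n) ((n + 1) * Real.log p)))
    (n p : ℕ) (α : Fin n → ℚ) (b : Fin n → ℤ) (hp : p.Prime) (hp5 : 5 ≤ p)
    (hα : ∀ i, α i ≠ 0 ∧ padicValRat p (α i) = 0)
    (hind : ∀ e : Fin n → ℤ, ∏ i, α i ^ e i = 1 → e = 0) (hb : b ≠ 0)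
    (hres : p ≠ 5 ∨ n ≤ 1 ∨ 6 ≤ n ∨ stewartB b ≤ 10 ^ 8 ∨ stewartG1 n ≤ Real.log (stewartB b)) :
    (padicValRat p (∏ i, α i ^ b i - 1) : ℝ) <
      stewartC n p (stewartDelta p α) * (∏ i, logHeight₁ (α i)) *
        max (Real.log (stewartB b)) ((n + 1) * (5.4 * n)) := by
  rcases Nat.lt_or_ge n 2 with hn2 | hn2
  · exact Stewart2013_lemma5_rat_of_le_one n p (by omega) α b hp hp5 hα hind hb
  have hY := H n p α b hn2 hp hp5 hα hind hb
  rcases hres with h5 | h1 | h6 | hB | hG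
  · have hp7 : 7 ≤ p := by
      rcases (show p = 5 ∨ p = 6 ∨ 7 ≤ p by omega) with h | h | h
      · exact absurd h h5
      · subst h; exact absurd hp (by norm_num)
      · exact h
    exact Stewart2013_lemma5_rat_of_printedYuBound_of_seven_le n p α b hn2 hp7 (fun i => (hα i).1)
      hind hY
  · omega
  · exact Stewart2013_lemma5_rat_of_printedYuBound H n p α b (Or.inr h6) hp hp5 hα hind hb
  · exact Stewart2013_lemma5_rat_of_stewartB_le n p α b hp hp5 hα hind hb hB
  · exact Stewart2013_lemma5_rat_of_printedYuBound_of_G1_le n p α b hn2 hp5 (fun i => (hα i).1)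
      hind hY hG

/-! ### From Yu's published display (`G₁^ℚ = yuG1Rat`, `5.84`): the printed form for `p ≥ 11`, and for `p ≥ 7`, `n ≥ 3` -/

/-- `log 13.74 < 2.65` (`13.74^{20} < e^{53}`). [folklore] -/
theorem log_d1374_lt : Real.log 13.74 < 2.65 := by
  rw [Real.log_lt_iff_lt_exp (by norm_num)]
  have h20 : Real.exp 2.65 ^ 20 = Real.exp 53 := by rw [← Real.exp_nat_mul]; norm_num
  have h53 : (13.74 : ℝ) ^ 20 < Real.exp 53 := by
    calc (13.74 : ℝ) ^ 20 < 2.7182818283 ^ 53 := by norm_num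
      _ < Real.exp 1 ^ 53 := by gcongr; exact Real.exp_one_gt_d9
      _ = Real.exp 53 := by rw [Real.exp_one_pow]; norm_num
  have h : (13.74 : ℝ) ^ 20 < Real.exp 2.65 ^ 20 := by rw [h20]; exact h53
  exact lt_of_pow_lt_pow_left₀ 20 (Real.exp_pos _).le h

/-- `log 17.69 < 2.9` (`17.69^{10} < e^{29}`). [folklore] -/
theorem log_d1769_lt : Real.log 17.69 < 2.9 := by
  rw [Real.log_lt_iff_lt_exp (by norm_num)]
  have h10 : Real.exp 2.9 ^ 10 = Real.exp 29 := by rw [← Real.exp_nat_mul]; norm_num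
  have h29 : (17.69 : ℝ) ^ 10 < Real.exp 29 := by
    calc (17.69 : ℝ) ^ 10 < 2.7182818283 ^ 29 := by norm_num
      _ < Real.exp 1 ^ 29 := by gcongr; exact Real.exp_one_gt_d9
      _ = Real.exp 29 := by rw [Real.exp_one_pow]; norm_num
  have h : (17.69 : ℝ) ^ 10 < Real.exp 2.9 ^ 10 := by rw [h10]; exact h29
  exact lt_of_pow_lt_pow_left₀ 10 (Real.exp_pos _).le h

/-- **`G₁^ℚ(n) ≤ 1.53 · (n+1) · 5.4 n` for `n ≥ 2`** (Yu's published `G₁(n,1)`, `5.84`; at `n = 2`: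
`49.05… ≤ 49.57…`, the defect of the printed step (19) being largest at `n = 2`).
[cite: Stewart2013, proof of Lemma 5, (19); Yu2013, (1.11), (1.30)–(1.31)] -/
theorem yuG1Rat_le_d153 {n : ℕ} (hn : 2 ≤ n) :
    yuG1Rat n ≤ 1.53 * (((n : ℝ) + 1) * (5.4 * n)) := by
  rw [yuG1Rat_def]
  have hn0 : (0 : ℝ) ≤ n + 1 := by positivity
  have hnR : (2 : ℝ) ≤ n := by exact_mod_cast hn
  have ha : (1.9 : ℝ) < Real.log 7 := log_seven_gt_d1
  have hb : Real.log 7 < 1.95 := log_seven_lt_d2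
  set x := (2 + Real.log 7) * n + 5.84 with hx
  have hxlo : 3.9 * (n : ℝ) + 5.84 < x := by rw [hx]; nlinarith
  have hxup : x < 3.95 * (n : ℝ) + 5.84 := by rw [hx]; nlinarith
  have hx0 : (0 : ℝ) < x := by linarith
  have hlogx : Real.log x ≤ Real.log 13.74 + (x / 13.74 - 1) := by
    have hsplit : Real.log x = Real.log 13.74 + Real.log (x / 13.74) := by
      rw [← Real.log_mul (by norm_num) (by positivity)]
      congr 1
      field_simp
    rw [hsplit]
    have := Real.log_le_sub_one_of_pos (show 0 < x / 13.74 by positivity)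
    linarith
  have h1374 := log_d1374_lt
  have hdiv : x / 13.74 < (3.95 * (n : ℝ) + 5.84) / 13.74 := by gcongr
  have hfin : x + Real.log x < 3.95 * n + 5.84 + 2.65 + ((3.95 * n + 5.84) / 13.74 - 1) := by
    linarith
  have hkey : 3.95 * (n : ℝ) + 5.84 + 2.65 + ((3.95 * n + 5.84) / 13.74 - 1) ≤ 8.262 * n := by
    field_simp
    nlinarith
  calc ((n : ℝ) + 1) * (x + Real.log x) ≤ ((n : ℝ) + 1) * (8.262 * n) :=
        mul_le_mul_of_nonneg_left (by linarith) hn0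
    _ = 1.53 * (((n : ℝ) + 1) * (5.4 * n)) := by ring

/-- **`G₁^ℚ(n) ≤ 1.3 · (n+1) · 5.4 n` for `n ≥ 3`** (at `n = 3`: `82.20… ≤ 84.24`).
[cite: Stewart2013, proof of Lemma 5, (19); Yu2013, (1.11), (1.30)–(1.31)] -/
theorem yuG1Rat_le_d13 {n : ℕ} (hn : 3 ≤ n) :
    yuG1Rat n ≤ 1.3 * (((n : ℝ) + 1) * (5.4 * n)) := by
  rw [yuG1Rat_def]
  have hn0 : (0 : ℝ) ≤ n + 1 := by positivity
  have hnR : (3 : ℝ) ≤ n := by exact_mod_cast hn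
  have ha : (1.9 : ℝ) < Real.log 7 := log_seven_gt_d1
  have hb : Real.log 7 < 1.95 := log_seven_lt_d2
  set x := (2 + Real.log 7) * n + 5.84 with hx
  have hxlo : 3.9 * (n : ℝ) + 5.84 < x := by rw [hx]; nlinarith
  have hxup : x < 3.95 * (n : ℝ) + 5.84 := by rw [hx]; nlinarith
  have hx0 : (0 : ℝ) < x := by linarith
  have hlogx : Real.log x ≤ Real.log 17.69 + (x / 17.69 - 1) := by
    have hsplit : Real.log x = Real.log 17.69 + Real.log (x / 17.69) := by
      rw [← Real.log_mul (by norm_num) (by positivity)]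
      congr 1
      field_simp
    rw [hsplit]
    have := Real.log_le_sub_one_of_pos (show 0 < x / 17.69 by positivity)
    linarith
  have h1769 := log_d1769_lt
  have hdiv : x / 17.69 < (3.95 * (n : ℝ) + 5.84) / 17.69 := by gcongr
  have hfin : x + Real.log x < 3.95 * n + 5.84 + 2.9 + ((3.95 * n + 5.84) / 17.69 - 1) := by
    linarith
  have hkey : 3.95 * (n : ℝ) + 5.84 + 2.9 + ((3.95 * n + 5.84) / 17.69 - 1) ≤ 7.02 * n := by
    field_simp
    nlinarith
  calc ((n : ℝ) + 1) * (x + Real.log x) ≤ ((n : ℝ) + 1) * (7.02 * n) :=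
        mul_le_mul_of_nonneg_left (by linarith) hn0
    _ = 1.3 * (((n : ℝ) + 1) * (5.4 * n)) := by ring

/-- The key real inequality of (17)–(18) with an abstract defect ratio `r`: if `L ≥ 1.6`, `A ≥ 4`,
`T ≥ 3`, `r ≤ 2`, `972.8 r ≤ 376 L²`, `M₁ ≤ r M₂` and `M₂ ≥ 10 T`, then
`972.8 · max(A, L) · max(M₁, T L) ≤ 376 · A · L² · M₂` (four cases; `r = 1` at `L ≥ log 5` is
`stewart_reduction_key`, `r = 1.46` at `L ≥ log 7` is `stewart_reduction_key₇`). [folklore] -/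
theorem stewart_reduction_key_gen {L A M₁ M₂ T r : ℝ} (hL : 1.6 ≤ L) (hA : 4 ≤ A) (hT : 3 ≤ T)
    (hr : r ≤ 2) (hrL : 972.8 * r ≤ 376 * L ^ 2) (hM₁ : M₁ ≤ r * M₂) (hM₂ : 10 * T ≤ M₂) :
    972.8 * max A L * max M₁ (T * L) ≤ 376 * A * L ^ 2 * M₂ := by
  have hL0 : 0 < L := by linarith
  have hA0 : 0 < A := by linarith
  have hT0 : 0 < T := by linarith
  have hM0 : 0 < M₂ := by linarith
  rcases le_total L A with hLA | hAL
  · rw [max_eq_left hLA]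
    rcases le_total (T * L) M₁ with h1 | h2
    · rw [max_eq_left h1]
      -- `972.8 A M₁ ≤ 972.8 r A M₂ ≤ 376 L² A M₂`
      have hAM : 0 ≤ A * M₂ := by positivity
      have h3 : 972.8 * A * M₁ ≤ 972.8 * A * (r * M₂) :=
        mul_le_mul_of_nonneg_left hM₁ (by positivity)
      nlinarith [mul_le_mul_of_nonneg_right hrL hAM]
    · rw [max_eq_right h2]
      -- `972.8 A T L ≤ 376 A L² M₂`, using `M₂ ≥ 10 T` and `L ≥ 1.6`
      have h3 : 972.8 * L ≤ 376 * L ^ 2 * 10 := by nlinarith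
      have hAT : 0 ≤ A * T := by positivity
      have h4 : 376 * A * L ^ 2 * (10 * T) ≤ 376 * A * L ^ 2 * M₂ :=
        mul_le_mul_of_nonneg_left hM₂ (by positivity)
      nlinarith [mul_le_mul_of_nonneg_right h3 hAT]
  · rw [max_eq_right hAL]
    rcases le_total (T * L) M₁ with h1 | h2
    · rw [max_eq_left h1]
      -- `972.8 L M₁ ≤ 972.8 r L M₂ ≤ 376 A L² M₂`, using `r ≤ 2`, `A ≥ 4`, `L ≥ A ≥ 4`
      have h3 : 972.8 * r ≤ 376 * A * L := by nlinarith
      have hLM : 0 ≤ L * M₂ := by positivity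
      have h4 : 972.8 * L * M₁ ≤ 972.8 * L * (r * M₂) :=
        mul_le_mul_of_nonneg_left hM₁ (by positivity)
      nlinarith [mul_le_mul_of_nonneg_right h3 hLM]
    · rw [max_eq_right h2]
      -- `972.8 L (T L) ≤ 376 A L² M₂`, using `A M₂ ≥ 40 T`
      have h3 : 972.8 * T ≤ 376 * A * (10 * T) := by nlinarith
      have h4 : 376 * A * (10 * T) ≤ 376 * A * M₂ := mul_le_mul_of_nonneg_left hM₂ (by positivity)
      have hLL : 0 ≤ L ^ 2 := by positivity
      nlinarith [mul_le_mul_of_nonneg_right (h3.trans h4) hLL]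

/-- **Steps (17)–(18) with an abstract second term (proved engine):** for `n ≥ 2`, `p ≥ 5`, if a
display `ord_p(Ξ − 1) < C₁ h(α₁)⋯h(αₙ) max(log B, G, (n+1) log p)` holds with
`G ≤ r · max(log B, (n+1) · 5.4n)`, `1 ≤ r ≤ 2` and `972.8 r ≤ 376 (log p)²`, then the printed statement of
Lemma 5 over `ℚ` holds (`max(log B, (n+1) · 5.4n)`, constant `376`). The slack `376 (log p)²/972.8`
of (18) against the `log 5` it is printed with pays for the defect `r` of (19).
[cite: Stewart2013, proof of Lemma 5, (17)–(19)] -/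
theorem Stewart2013_lemma5_rat_printed_of_display_of_ratio (n p : ℕ) (α : Fin n → ℚ)
    (b : Fin n → ℤ) (G r : ℝ) (hn : 2 ≤ n) (hp5 : 5 ≤ p) (hα0 : ∀ i, α i ≠ 0)
    (hind : ∀ e : Fin n → ℤ, ∏ i, α i ^ e i = 1 → e = 0)
    (hGr : G ≤ r * max (Real.log (stewartB b)) (((n : ℝ) + 1) * (5.4 * n))) (hr1 : 1 ≤ r)
    (hr2 : r ≤ 2)
    (hrL : 972.8 * r ≤ 376 * Real.log p ^ 2)
    (hYu : (padicValRat p (∏ i, α i ^ b i - 1) : ℝ) <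
      stewartC1 n p (stewartDelta p α) * (∏ i, logHeight₁ (α i)) *
        max (Real.log (stewartB b)) (max G ((n + 1) * Real.log p))) :
    (padicValRat p (∏ i, α i ^ b i - 1) : ℝ) <
      stewartC n p (stewartDelta p α) * (∏ i, logHeight₁ (α i)) *
        max (Real.log (stewartB b)) ((n + 1) * (5.4 * n)) := by
  have hp' : (5 : ℝ) ≤ p := by exact_mod_cast hp5
  -- names
  set L := Real.log p with hLdef
  set δ := stewartDelta p α with hδdef
  set P := ∏ i, logHeight₁ (α i) with hPdef
  set M₁ := max (Real.log (stewartB b)) G with hM₁def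
  set M₂ := max (Real.log (stewartB b)) (((n : ℝ) + 1) * (5.4 * n)) with hM₂def
  set A := Real.log (Real.exp 4 * (n + 1)) with hAdef
  set W := Real.sqrt ((n : ℝ) + 1) * (7 * Real.exp 1 * (((p : ℝ) - 1) / ((p : ℝ) - 2))) ^ n *
    max ((p : ℝ) / δ * ((n : ℝ) / L) ^ n) (Real.exp n * L) with hWdef
  -- basic bounds
  have hL : 1.6089 < L := log_gt_d4_of_five_le hp5
  have hL0 : 0 < L := by linarith
  have hA : 4 ≤ A := by
    rw [hAdef, Real.log_mul (Real.exp_pos 4).ne' (by positivity), Real.log_exp]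
    have : (0 : ℝ) ≤ Real.log (n + 1) :=
      Real.log_nonneg (by have : (0:ℝ) ≤ n := Nat.cast_nonneg n; linarith)
    linarith
  have hnR : (2 : ℝ) ≤ n := by exact_mod_cast hn
  have hT : (3 : ℝ) ≤ (n : ℝ) + 1 := by linarith
  have hF0 : 0 ≤ ((p : ℝ) - 1) / ((p : ℝ) - 2) := div_nonneg (by linarith) (by linarith)
  have hMX0 : 0 ≤ max ((p : ℝ) / δ * ((n : ℝ) / L) ^ n) (Real.exp n * L) :=
    le_trans (mul_nonneg (Real.exp_pos _).le hL0.le) (le_max_right _ _)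
  have hW0 : 0 ≤ W := by
    rw [hWdef]
    exact mul_nonneg (mul_nonneg (Real.sqrt_nonneg _) (pow_nonneg (by positivity) _)) hMX0
  -- heights: `h(αᵢ) ≥ log 2`, so `P > 0`
  have hP0 : 0 < P := by
    rw [hPdef]
    refine Finset.prod_pos fun i _ => lt_of_lt_of_le ?_
      (log_two_le_logHeight₁ (hα0 i) (ne_one_and_ne_neg_one_of_multIndep hind i).1
        (ne_one_and_ne_neg_one_of_multIndep hind i).2)
    linarith [Real.log_two_gt_d9]
  -- `M₂ ≥ (n+1) 5.4 n ≥ 10 (n+1)` and `M₁ ≤ r M₂`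
  have hS : 10 * ((n : ℝ) + 1) ≤ ((n : ℝ) + 1) * (5.4 * n) := by nlinarith
  have hM₂ : 10 * ((n : ℝ) + 1) ≤ M₂ := le_trans hS (le_max_right _ _)
  have hM₂0 : 0 ≤ M₂ := by linarith
  have hM₁ : M₁ ≤ r * M₂ := by
    apply max_le
    · have h1 : Real.log (stewartB b) ≤ M₂ := le_max_left _ _
      nlinarith
    · exact hGr
  have hM3 : max (Real.log (stewartB b)) (max G ((n + 1) * L)) =
      max M₁ (((n : ℝ) + 1) * L) := (max_assoc _ _ _).symm
  -- `C₁ ≤ 972.8 · W · max(A, L) / L²` and `C = 376 W A`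
  have hC1 : stewartC1 n p δ ≤ 972.8 * W * (max A L / L ^ 2) := stewartC1_le n hp5 δ
  have hC : stewartC n p δ = 376 * W * A := by
    rw [stewartC_def, hWdef]; ring
  -- the key inequality
  have hkey : 972.8 * max A L * max M₁ (((n : ℝ) + 1) * L) ≤ 376 * A * L ^ 2 * M₂ :=
    stewart_reduction_key_gen (by linarith) hA hT hr2 hrL hM₁ hM₂
  -- assemble
  have hM30 : 0 ≤ max M₁ (((n : ℝ) + 1) * L) :=
    le_trans (by positivity : (0 : ℝ) ≤ ((n : ℝ) + 1) * L) (le_max_right _ _)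
  rw [hM3] at hYu
  calc (padicValRat p (∏ i, α i ^ b i - 1) : ℝ)
      < stewartC1 n p δ * P * max M₁ (((n : ℝ) + 1) * L) := hYu
    _ ≤ 972.8 * W * (max A L / L ^ 2) * P * max M₁ (((n : ℝ) + 1) * L) := by
        apply mul_le_mul_of_nonneg_right _ hM30
        exact mul_le_mul_of_nonneg_right hC1 hP0.le
    _ = (972.8 * max A L * max M₁ (((n : ℝ) + 1) * L)) * (W * P / L ^ 2) := by
        field_simp
    _ ≤ (376 * A * L ^ 2 * M₂) * (W * P / L ^ 2) :=
        mul_le_mul_of_nonneg_right hkey (div_nonneg (mul_nonneg hW0 hP0.le) (by positivity))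
    _ = 376 * W * A * P * M₂ := by
        field_simp
    _ = stewartC n p δ * P * M₂ := by rw [hC]

/-- **For `p ≥ 11` and every `n ≥ 2`, Yu's PUBLISHED display over `ℚ` (second term
`G₁^ℚ = yuG1Rat n`, i.e. `a₁⁽¹⁾ = a₂⁽¹⁾ = 5.84`) gives the printed statement of Lemma 5 exactly:**
`log p ≥ log 8 = 3 log 2` and `376 (3 log 2)²/972.8 = 1.671… ≥ 1.53 ≥ G₁^ℚ/((n+1) · 5.4n)`
(`yuG1Rat_le_d153`). Hypothesis `hYu` is NOT proved here (it is Yu's Theorem I over `ℚ`, cf.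
`Stewart2013_lemma5_rat_of_yuBound`). [cite: Stewart2013, proof of Lemma 5, (17)–(19); Yu2013,
Main Theorem (1.18), (1.11), §1.3 case (III.2)] -/
theorem Stewart2013_lemma5_rat_printed_of_yuBound_of_eleven_le (n p : ℕ) (α : Fin n → ℚ)
    (b : Fin n → ℤ) (hn : 2 ≤ n) (hp11 : 11 ≤ p) (hα0 : ∀ i, α i ≠ 0)
    (hind : ∀ e : Fin n → ℤ, ∏ i, α i ^ e i = 1 → e = 0)
    (hYu : (padicValRat p (∏ i, α i ^ b i - 1) : ℝ) <
      stewartC1 n p (stewartDelta p α) * (∏ i, logHeight₁ (α i)) *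
        max (Real.log (stewartB b)) (max (yuG1Rat n) ((n + 1) * Real.log p))) :
    (padicValRat p (∏ i, α i ^ b i - 1) : ℝ) <
      stewartC n p (stewartDelta p α) * (∏ i, logHeight₁ (α i)) *
        max (Real.log (stewartB b)) ((n + 1) * (5.4 * n)) := by
  have hp5 : 5 ≤ p := le_trans (by norm_num) hp11
  have hlog8 : 3 * Real.log 2 ≤ Real.log p := by
    have h8 : Real.log 8 = 3 * Real.log 2 := by
      rw [show (8 : ℝ) = 2 ^ 3 by norm_num, Real.log_pow]; norm_num
    rw [← h8]
    exact Real.log_le_log (by norm_num) (by exact_mod_cast le_trans (by norm_num) hp11)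
  have h2 := Real.log_two_gt_d9
  have hL0 : (2.0794 : ℝ) < Real.log p := by linarith
  have hrL : 972.8 * (1.53 : ℝ) ≤ 376 * Real.log p ^ 2 := by nlinarith
  exact Stewart2013_lemma5_rat_printed_of_display_of_ratio n p α b (yuG1Rat n) 1.53 hn hp5 hα0 hind
    (le_trans (yuG1Rat_le_d153 hn) (mul_le_mul_of_nonneg_left (le_max_right _ _) (by norm_num)))
    (by norm_num) (by norm_num) hrL hYu

/-- **For `p ≥ 7` and every `n ≥ 3`, Yu's published display over `ℚ` gives the printed statement
of Lemma 5 exactly** (`376 (log 7)²/972.8 = 1.4635… ≥ 1.3 ≥ G₁^ℚ/((n+1) · 5.4n)` for `n ≥ 3`,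
`yuG1Rat_le_d13`; at `p = 7`, `n = 2` the defect `1.514…` exceeds the slack).
[cite: Stewart2013, proof of Lemma 5, (17)–(19); Yu2013, Main Theorem (1.18), (1.11), §1.3
case (III.2)] -/
theorem Stewart2013_lemma5_rat_printed_of_yuBound_of_seven_le_of_three_le (n p : ℕ)
    (α : Fin n → ℚ) (b : Fin n → ℤ) (hn : 3 ≤ n) (hp7 : 7 ≤ p) (hα0 : ∀ i, α i ≠ 0)
    (hind : ∀ e : Fin n → ℤ, ∏ i, α i ^ e i = 1 → e = 0)
    (hYu : (padicValRat p (∏ i, α i ^ b i - 1) : ℝ) <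
      stewartC1 n p (stewartDelta p α) * (∏ i, logHeight₁ (α i)) *
        max (Real.log (stewartB b)) (max (yuG1Rat n) ((n + 1) * Real.log p))) :
    (padicValRat p (∏ i, α i ^ b i - 1) : ℝ) <
      stewartC n p (stewartDelta p α) * (∏ i, logHeight₁ (α i)) *
        max (Real.log (stewartB b)) ((n + 1) * (5.4 * n)) := by
  have hp5 : 5 ≤ p := le_trans (by norm_num) hp7
  have hL : 1.9458 < Real.log p := log_gt_of_seven_le hp7
  have hrL : 972.8 * (1.3 : ℝ) ≤ 376 * Real.log p ^ 2 := by nlinarith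
  exact Stewart2013_lemma5_rat_printed_of_display_of_ratio n p α b (yuG1Rat n) 1.3 (by omega) hp5
    hα0 hind (le_trans (yuG1Rat_le_d13 hn) (mul_le_mul_of_nonneg_left (le_max_right _ _) (by norm_num)))
    (by norm_num) (by norm_num) hrL hYu

/-- **The printed Lemma 5 over `ℚ` from Yu's PUBLISHED Theorem I — what the published argument
reaches (proved reduction).** If Yu's display over `ℚ` with the published `G₁(n,1) = yuG1Rat n`
holds for all `n ≥ 2` (hypothesis `H`: for `K = ℚ`, `p ≥ 5`, what [Yu2013, Main Theorem (1.18),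
`i = 1`] gives in case (III.2) after the elementary remarks of Stewart's proof; NOT proved here),
then the PRINTED statement of Lemma 5 over `ℚ` (`max(log B, (n+1) · 5.4n)`, constant `376`) holds
for `n, p, α, b` whenever `11 ≤ p ∨ (7 ≤ p ∧ 3 ≤ n) ∨ n ≤ 1 ∨ B ≤ 10⁸ ∨ G₁^ℚ(n) ≤ log B`
(`…_of_eleven_le`, `…_of_seven_le_of_three_le`, `Stewart2013_lemma5_rat_of_le_one`,
`Stewart2013_lemma5_rat_of_stewartB_le`, and the engine with `r = 1` when `G₁^ℚ(n) ≤ log B`).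
Together with step (19) for Yu's constants, valid from `n = 7` on (all `p`), this leaves of the
printed form exactly the corner `(p = 5, 2 ≤ n ≤ 6)` and `(p = 7, n = 2)` with
`10⁸ < B < e^{G₁^ℚ(n)}` named in the *Restatement record* of `StewartYuPadicLogForms.lean`.
[cite: Stewart2013, Lemma 5 = Lemma 3.1 and its proof, (17)–(19); Yu2013, Main Theorem (1.18),
(1.9), (1.11), (1.13), §1.3 case (III.2)] -/
theorem Stewart2013_lemma5_rat_printed_of_yuBound_of_not_residual
    (H : ∀ (n p : ℕ) (α : Fin n → ℚ) (b : Fin n → ℤ), 2 ≤ n → p.Prime → 5 ≤ p →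
      (∀ i, α i ≠ 0 ∧ padicValRat p (α i) = 0) →
      (∀ e : Fin n → ℤ, ∏ i, α i ^ e i = 1 → e = 0) → b ≠ 0 →
      (padicValRat p (∏ i, α i ^ b i - 1) : ℝ) <
        stewartC1 n p (stewartDelta p α) * (∏ i, logHeight₁ (α i)) *
          max (Real.log (stewartB b)) (max (yuG1Rat n) ((n + 1) * Real.log p)))
    (n p : ℕ) (α : Fin n → ℚ) (b : Fin n → ℤ) (hp : p.Prime) (hp5 : 5 ≤ p)
    (hα : ∀ i, α i ≠ 0 ∧ padicValRat p (α i) = 0)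
    (hind : ∀ e : Fin n → ℤ, ∏ i, α i ^ e i = 1 → e = 0) (hb : b ≠ 0)
    (hres : 11 ≤ p ∨ (7 ≤ p ∧ 3 ≤ n) ∨ n ≤ 1 ∨ stewartB b ≤ 10 ^ 8 ∨
      yuG1Rat n ≤ Real.log (stewartB b)) :
    (padicValRat p (∏ i, α i ^ b i - 1) : ℝ) <
      stewartC n p (stewartDelta p α) * (∏ i, logHeight₁ (α i)) *
        max (Real.log (stewartB b)) ((n + 1) * (5.4 * n)) := by
  rcases Nat.lt_or_ge n 2 with hn2 | hn2
  · exact Stewart2013_lemma5_rat_of_le_one n p (by omega) α b hp hp5 hα hind hb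
  have hY := H n p α b hn2 hp hp5 hα hind hb
  have hα0 : ∀ i, α i ≠ 0 := fun i => (hα i).1
  rcases hres with h11 | ⟨h7, h3⟩ | h1 | hB | hGB
  · exact Stewart2013_lemma5_rat_printed_of_yuBound_of_eleven_le n p α b hn2 h11 hα0 hind hY
  · exact Stewart2013_lemma5_rat_printed_of_yuBound_of_seven_le_of_three_le n p α b h3 h7 hα0
      hind hY
  · omega
  · exact Stewart2013_lemma5_rat_of_stewartB_le n p α b hp hp5 hα hind hb hB
  · -- `G₁^ℚ ≤ log B`: the engine with `r = 1` (`972.8 ≤ 376 (log p)²` for `p ≥ 5`)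
    exact Stewart2013_lemma5_rat_printed_of_display_of_ratio n p α b (yuG1Rat n) 1 hn2 hp5 hα0
      hind (by rw [one_mul]; exact le_trans hGB (le_max_left _ _)) le_rfl (by norm_num)
      (by rw [mul_one]; exact stewart_const_le_log_sq hp5) hY

/-- **The printed Lemma 5 over `ℚ` holds outside the corner `(p = 5, 2 ≤ n ≤ 6) ∪ (p = 7, n = 2)`,
`10⁸ < B < e^{G₁^ℚ(n)}`, granted Yu's published Theorem I over `ℚ` (proved reduction, final form).**
Hypothesis `H` is verbatim that of `Stewart2013_lemma5_rat_of_yuBound` (Yu's display with the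
published `G₁(n,1) = yuG1Rat n`; NOT proved in the tree). Conclusion: the PRINTED statement
`ord_p(Ξ − 1) < C h(α₁)⋯h(αₙ) max(log B, (n+1) · 5.4n)` whenever
`11 ≤ p ∨ (7 ≤ p ∧ 3 ≤ n) ∨ n ≤ 1 ∨ 7 ≤ n ∨ B ≤ 10⁸ ∨ G₁^ℚ(n) ≤ log B` — the previous theorem plus
the case `7 ≤ n` (all `p`), which is step (19) with Yu's constants (`yuG1Rat_le_printed`) applied to
the restated fact (`Stewart2013_lemma5_rat_of_yuBound`, `Stewart2013_lemma5_rat.printed_of`). The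
complement of this disjunction under `p ≥ 5` prime is exactly `(p = 5 ∧ 2 ≤ n ≤ 6) ∨ (p = 7 ∧ n = 2)`
with `10⁸ < B` and `log B < G₁^ℚ(n)`: the corner recorded in the *Restatement record* of
`StewartYuPadicLogForms.lean`, where (19) fails and (18) has too little slack.
[cite: Stewart2013, Lemma 5 = Lemma 3.1 and its proof, (17)–(19); Yu2013, Main Theorem (1.18),
(1.9), (1.11), (1.13), §1.3 case (III.2)] -/
theorem Stewart2013_lemma5_rat_printed_of_yuBound_outside_corner
    (H : ∀ (n p : ℕ) (α : Fin n → ℚ) (b : Fin n → ℤ), 2 ≤ n → p.Prime → 5 ≤ p →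
      (∀ i, α i ≠ 0 ∧ padicValRat p (α i) = 0) →
      (∀ e : Fin n → ℤ, ∏ i, α i ^ e i = 1 → e = 0) → b ≠ 0 →
      (padicValRat p (∏ i, α i ^ b i - 1) : ℝ) <
        stewartC1 n p (stewartDelta p α) * (∏ i, logHeight₁ (α i)) *
          max (Real.log (stewartB b)) (max (yuG1Rat n) ((n + 1) * Real.log p)))
    (n p : ℕ) (α : Fin n → ℚ) (b : Fin n → ℤ) (hp : p.Prime) (hp5 : 5 ≤ p)
    (hα : ∀ i, α i ≠ 0 ∧ padicValRat p (α i) = 0)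
    (hind : ∀ e : Fin n → ℤ, ∏ i, α i ^ e i = 1 → e = 0) (hb : b ≠ 0)
    (hres : 11 ≤ p ∨ (7 ≤ p ∧ 3 ≤ n) ∨ n ≤ 1 ∨ 7 ≤ n ∨ stewartB b ≤ 10 ^ 8 ∨
      yuG1Rat n ≤ Real.log (stewartB b)) :
    (padicValRat p (∏ i, α i ^ b i - 1) : ℝ) <
      stewartC n p (stewartDelta p α) * (∏ i, logHeight₁ (α i)) *
        max (Real.log (stewartB b)) ((n + 1) * (5.4 * n)) := by
  rcases hres with h11 | h73 | h1 | h7 | hB | hGB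
  · exact Stewart2013_lemma5_rat_printed_of_yuBound_of_not_residual H n p α b hp hp5 hα hind hb
      (Or.inl h11)
  · exact Stewart2013_lemma5_rat_printed_of_yuBound_of_not_residual H n p α b hp hp5 hα hind hb
      (Or.inr (Or.inl h73))
  · exact Stewart2013_lemma5_rat_printed_of_yuBound_of_not_residual H n p α b hp hp5 hα hind hb
      (Or.inr (Or.inr (Or.inl h1)))
  · exact (Stewart2013_lemma5_rat_of_yuBound H).printed_of n p α b hp hp5 hα hind hb (Or.inl h7)
  · exact Stewart2013_lemma5_rat_printed_of_yuBound_of_not_residual H n p α b hp hp5 hα hind hb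
      (Or.inr (Or.inr (Or.inr (Or.inl hB))))
  · exact Stewart2013_lemma5_rat_printed_of_yuBound_of_not_residual H n p α b hp hp5 hα hind hb
      (Or.inr (Or.inr (Or.inr (Or.inr hGB))))

/-- The corner is what it is claimed to be: for a prime `p ≥ 5`, the failure of the disjunction
`11 ≤ p ∨ (7 ≤ p ∧ 3 ≤ n) ∨ n ≤ 1 ∨ 7 ≤ n` is equivalent to `(p = 5 ∧ 2 ≤ n ≤ 6) ∨ (p = 7 ∧ n = 2)`
(elementary; recorded to pin down the residual set of the previous theorem). [folklore] -/
theorem stewart_corner_iff {n p : ℕ} (hp : p.Prime) (hp5 : 5 ≤ p) :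
    ¬ (11 ≤ p ∨ (7 ≤ p ∧ 3 ≤ n) ∨ n ≤ 1 ∨ 7 ≤ n) ↔
      (p = 5 ∧ 2 ≤ n ∧ n ≤ 6) ∨ (p = 7 ∧ n = 2) := by
  have hp' : p = 5 ∨ p = 7 ∨ 11 ≤ p := by
    rcases Nat.lt_or_ge p 11 with h | h
    · interval_cases p <;> simp_all (config := {decide := true})
    · exact Or.inr (Or.inr h)
  rcases hp' with rfl | rfl | h11
  · omega
  · omega
  · omega

/-! ### §U. The uniform shape of Bilu–Hong–Gun (2021, Theorem 3.1) over `ℚ` -/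

/-- `C ≥ 0` for `p ≥ 5` and `δ > 0`. [cite: Stewart2013, Lemma 5] -/
theorem stewartC_nonneg (n : ℕ) {p : ℕ} (hp5 : 5 ≤ p) {δ : ℝ} (hδ : 0 < δ) :
    0 ≤ stewartC n p δ := by
  rw [stewartC_def]
  have hp' : (5 : ℝ) ≤ p := by exact_mod_cast hp5
  have hfrac : 0 ≤ ((p : ℝ) - 1) / ((p : ℝ) - 2) := div_nonneg (by linarith) (by linarith)
  have hlog : 0 ≤ Real.log (Real.exp 4 * (n + 1)) := by
    apply Real.log_nonneg
    have h4 : (1 : ℝ) ≤ Real.exp 4 := Real.one_le_exp (by norm_num)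
    have hn : (1 : ℝ) ≤ (n : ℝ) + 1 := by
      have := (Nat.cast_nonneg n : (0 : ℝ) ≤ n)
      linarith
    nlinarith
  have hlogp : 0 ≤ Real.log p := Real.log_nonneg (by linarith)
  have hΩ : 0 ≤ max ((p : ℝ) / δ * ((n : ℝ) / Real.log p) ^ n) (Real.exp n * Real.log p) :=
    le_max_of_le_right (by positivity)
  have hA : 0 ≤ (7 * Real.exp 1 * (((p : ℝ) - 1) / ((p : ℝ) - 2))) ^ n := by positivity
  positivity

/-- `7e(p-1)/(p-2) ≤ 30` for `p ≥ 5` (`(p-1)/(p-2) ≤ 4/3`, `e < 2.72`).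
[cite: BiluGunHong2022, proof of Theorem 3.1] -/
theorem stewart_base_le_thirty {p : ℕ} (hp5 : 5 ≤ p) :
    7 * Real.exp 1 * (((p : ℝ) - 1) / ((p : ℝ) - 2)) ≤ 30 := by
  have hp' : (5 : ℝ) ≤ p := by exact_mod_cast hp5
  have he : Real.exp 1 < 2.7182818286 := Real.exp_one_lt_d9
  have he0 : 0 < Real.exp 1 := Real.exp_pos 1
  have hfrac : ((p : ℝ) - 1) / ((p : ℝ) - 2) ≤ 4 / 3 := by
    rw [div_le_div_iff₀ (by linarith) (by norm_num)]
    linarith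
  have hfrac0 : 0 ≤ ((p : ℝ) - 1) / ((p : ℝ) - 2) := div_nonneg (by linarith) (by linarith)
  calc 7 * Real.exp 1 * (((p : ℝ) - 1) / ((p : ℝ) - 2)) ≤ 7 * 2.7182818286 * (4 / 3) := by
        gcongr
    _ ≤ 30 := by norm_num

/-- `log(e⁴(n+1)) ≤ 8 log⁺ n` for `n ≥ 1`, `log⁺ = max(1, log)`.
[cite: BiluGunHong2022, proof of Theorem 3.1] -/
theorem log_exp_four_mul_le {n : ℕ} (hn : 1 ≤ n) :
    Real.log (Real.exp 4 * (n + 1)) ≤ 8 * max 1 (Real.log n) := by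
  have hnR : (1 : ℝ) ≤ n := by exact_mod_cast hn
  have hsplit : Real.log (Real.exp 4 * (n + 1)) = 4 + Real.log ((n : ℝ) + 1) := by
    rw [Real.log_mul (Real.exp_pos 4).ne' (by positivity), Real.log_exp]
  have hlog2 : Real.log 2 < 0.6931471808 := Real.log_two_lt_d9
  have hle : Real.log ((n : ℝ) + 1) ≤ Real.log 2 + Real.log n := by
    rw [← Real.log_mul (by norm_num) (by positivity)]
    exact Real.log_le_log (by positivity) (by linarith)
  rw [hsplit]
  rcases le_or_gt (Real.log (n : ℝ)) 1 with h1 | h1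
  · have : max 1 (Real.log (n : ℝ)) = 1 := max_eq_left h1
    rw [this]; linarith
  · have : max 1 (Real.log (n : ℝ)) = Real.log n := max_eq_right h1.le
    rw [this]; nlinarith

/-- `√(n+1) ≤ √2 · √n` for `n ≥ 1`. [cite: BiluGunHong2022, proof of Theorem 3.1] -/
theorem sqrt_succ_le {n : ℕ} (hn : 1 ≤ n) :
    Real.sqrt ((n : ℝ) + 1) ≤ Real.sqrt 2 * Real.sqrt n := by
  have hnR : (1 : ℝ) ≤ n := by exact_mod_cast hn
  rw [← Real.sqrt_mul (by norm_num : (0 : ℝ) ≤ 2)]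
  exact Real.sqrt_le_sqrt (by linarith)

/-- `n² √n = n^{5/2}` for `n ≥ 1` (real powers). [folklore] -/
theorem sq_mul_sqrt_eq_rpow {n : ℕ} (hn : 1 ≤ n) :
    (n : ℝ) ^ 2 * Real.sqrt n = (n : ℝ) ^ ((5 : ℝ) / 2) := by
  have hn0 : (0 : ℝ) < n := by exact_mod_cast hn
  rw [Real.sqrt_eq_rpow, show ((5 : ℝ) / 2) = (2 : ℝ) + (1 / 2 : ℝ) by norm_num,
    Real.rpow_add hn0, Real.rpow_two]

/-- **The arithmetic of [BiluGunHong2022, proof of Theorem 3.1] over `ℚ` (engine).** If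
`v < C(n,p,δ_S) · H · max(log B_S, G)` with `G ≤ 13 n²`, `2 ≤ B_S`, `log B_S ≤ log⁺ B`, `H ≥ 0`,
`0 < δ ≤ δ_S`, `n ≥ 1`, `p ≥ 5`, then
`v ≤ 10⁵ · 30ⁿ · n^{5/2} · log⁺ n · H · max(p δ⁻¹ (n/log p)ⁿ, eⁿ log p) · log⁺ B`
(`376 · √2 · 8 · 13 < 10⁵`, `7e(p−1)/(p−2) ≤ 30`). [cite: BiluGunHong2022, Theorem 3.1 (proof)] -/
theorem bhg_uniform_engine {n p : ℕ} (hn : 1 ≤ n) (hp5 : 5 ≤ p) {δ δS H v G LB : ℝ} {BS : ℕ}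
    (hδ0 : 0 < δ) (hδ : δ ≤ δS) (hH : 0 ≤ H) (hG : G ≤ 13 * (n : ℝ) ^ 2) (hBS : 2 ≤ BS)
    (hLB : Real.log BS ≤ LB) (hLB1 : 1 ≤ LB)
    (hv : v < stewartC n p δS * H * max (Real.log BS) G) :
    v ≤ 10 ^ 5 * 30 ^ n * (n : ℝ) ^ ((5 : ℝ) / 2) * max 1 (Real.log n) * H *
        max ((p : ℝ) / δ * ((n : ℝ) / Real.log p) ^ n) (Real.exp n * Real.log p) * LB := by
  have hnR : (1 : ℝ) ≤ n := by exact_mod_cast hn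
  have hp' : (5 : ℝ) ≤ p := by exact_mod_cast hp5
  set Ω := max ((p : ℝ) / δ * ((n : ℝ) / Real.log p) ^ n) (Real.exp n * Real.log p) with hΩ
  set A := 7 * Real.exp 1 * (((p : ℝ) - 1) / ((p : ℝ) - 2)) with hA
  set M := max (Real.log BS) G with hM
  set Lp := max 1 (Real.log (n : ℝ)) with hLp
  -- positivity bookkeeping
  have hlogp : 0 < Real.log p := Real.log_pos (by linarith)
  have hΩ0 : 0 < Ω := lt_max_of_lt_right (by positivity)
  have hA0 : 0 ≤ A := by
    rw [hA]; exact mul_nonneg (by positivity) (div_nonneg (by linarith) (by linarith))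
  have hBSR : (2 : ℝ) ≤ BS := by exact_mod_cast hBS
  have hM0 : 0 < M := lt_max_of_lt_left (Real.log_pos (by linarith))
  have hLp1 : 1 ≤ Lp := le_max_left _ _
  -- Step 1: `C(δ_S) ≤ C(δ)` and `M ≤ 13 n² LB`.
  have hC : stewartC n p δS ≤ stewartC n p δ := stewartC_anti hp5 hδ0 hδ
  have hC0 : 0 ≤ stewartC n p δ := stewartC_nonneg n hp5 hδ0
  have hM13 : M ≤ 13 * (n : ℝ) ^ 2 * LB := by
    have h13 : (1 : ℝ) ≤ 13 * (n : ℝ) ^ 2 := by nlinarith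
    apply max_le
    · calc Real.log (BS : ℝ) ≤ LB := hLB
        _ = 1 * LB := (one_mul _).symm
        _ ≤ 13 * (n : ℝ) ^ 2 * LB := mul_le_mul_of_nonneg_right h13 (by linarith)
    · calc G ≤ 13 * (n : ℝ) ^ 2 := hG
        _ = 13 * (n : ℝ) ^ 2 * 1 := (mul_one _).symm
        _ ≤ 13 * (n : ℝ) ^ 2 * LB := mul_le_mul_of_nonneg_left hLB1 (by positivity)
  have h1 : v < stewartC n p δ * H * (13 * (n : ℝ) ^ 2 * LB) := by
    calc v < stewartC n p δS * H * M := hv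
      _ ≤ stewartC n p δ * H * M := by
          apply mul_le_mul_of_nonneg_right _ hM0.le
          exact mul_le_mul_of_nonneg_right hC hH
      _ ≤ stewartC n p δ * H * (13 * (n : ℝ) ^ 2 * LB) :=
          mul_le_mul_of_nonneg_left hM13 (mul_nonneg hC0 hH)
  -- Step 2: `C(δ) ≤ 376 · (√2 √n) · 30ⁿ · (8 log⁺ n) · Ω`.
  have hCexp : stewartC n p δ = 376 * Real.sqrt (n + 1) * A ^ n *
      Real.log (Real.exp 4 * (n + 1)) * Ω := by rw [stewartC_def]
  have hsqrt : Real.sqrt ((n : ℝ) + 1) ≤ Real.sqrt 2 * Real.sqrt n := sqrt_succ_le hn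
  have hAn : A ^ n ≤ (30 : ℝ) ^ n := pow_le_pow_left₀ hA0 (stewart_base_le_thirty hp5) n
  have hlog : Real.log (Real.exp 4 * (n + 1)) ≤ 8 * Lp := log_exp_four_mul_le hn
  have hlog0 : 0 ≤ Real.log (Real.exp 4 * (n + 1)) := by
    apply Real.log_nonneg
    have h4 : (1 : ℝ) ≤ Real.exp 4 := Real.one_le_exp (by norm_num)
    nlinarith
  have hCle : stewartC n p δ ≤ 376 * (Real.sqrt 2 * Real.sqrt n) * (30 : ℝ) ^ n * (8 * Lp) * Ω := by
    rw [hCexp]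
    gcongr
  -- Step 3: numerics `376 · √2 · 8 · 13 ≤ 10⁵`.
  have hs2 : Real.sqrt 2 < 1.4143 := by
    rw [Real.sqrt_lt' (by norm_num)]; norm_num
  have hs20 : 0 ≤ Real.sqrt 2 := Real.sqrt_nonneg 2
  have hsn0 : 0 ≤ Real.sqrt (n : ℝ) := Real.sqrt_nonneg _
  have hnum : 376 * Real.sqrt 2 * 8 * 13 ≤ (10 : ℝ) ^ 5 := by nlinarith
  -- Step 4: assemble.
  have h30 : (0 : ℝ) ≤ 30 ^ n := by positivity
  have hrpow : (n : ℝ) ^ 2 * Real.sqrt n = (n : ℝ) ^ ((5 : ℝ) / 2) := sq_mul_sqrt_eq_rpow hn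
  have h2 : stewartC n p δ * H * (13 * (n : ℝ) ^ 2 * LB) ≤
      376 * (Real.sqrt 2 * Real.sqrt n) * (30 : ℝ) ^ n * (8 * Lp) * Ω * H *
        (13 * (n : ℝ) ^ 2 * LB) := by
    apply mul_le_mul_of_nonneg_right _ (by positivity)
    exact mul_le_mul_of_nonneg_right hCle hH
  have h3 : 376 * (Real.sqrt 2 * Real.sqrt n) * (30 : ℝ) ^ n * (8 * Lp) * Ω * H *
        (13 * (n : ℝ) ^ 2 * LB) =
      (376 * Real.sqrt 2 * 8 * 13) * ((30 : ℝ) ^ n * ((n : ℝ) ^ 2 * Real.sqrt n) * Lp * H *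
        Ω * LB) := by ring
  have h4 : (376 * Real.sqrt 2 * 8 * 13) * ((30 : ℝ) ^ n * ((n : ℝ) ^ 2 * Real.sqrt n) * Lp * H *
        Ω * LB) ≤ (10 : ℝ) ^ 5 * ((30 : ℝ) ^ n * ((n : ℝ) ^ 2 * Real.sqrt n) * Lp * H * Ω * LB) := by
    apply mul_le_mul_of_nonneg_right hnum
    have : 0 ≤ Lp := by linarith
    positivity
  have hfin : v < (10 : ℝ) ^ 5 * ((30 : ℝ) ^ n * ((n : ℝ) ^ 2 * Real.sqrt n) * Lp * H * Ω * LB) := by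
    calc v < _ := h1
      _ ≤ _ := h2
      _ = _ := h3
      _ ≤ _ := h4
  rw [hrpow] at hfin
  have : (10 : ℝ) ^ 5 * ((30 : ℝ) ^ n * (n : ℝ) ^ ((5 : ℝ) / 2) * Lp * H * Ω * LB) =
      10 ^ 5 * 30 ^ n * (n : ℝ) ^ ((5 : ℝ) / 2) * Lp * H * Ω * LB := by ring
  rw [this] at hfin
  exact hfin.le


/-- `log B_S ≤ log⁺ B` where `B_S = max(2, |bᵢ|)` is Stewart's `B` and `B = max |bᵢ|` is the `B`
of [BiluGunHong2022] (`log 2 < 1`). [cite: BiluGunHong2022, Theorem 3.1; Stewart2013, Lemma 5] -/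
theorem log_stewartB_le {n : ℕ} (b : Fin n → ℤ) :
    Real.log (stewartB b) ≤ max 1 (Real.log ((univ.sup fun i => (b i).natAbs : ℕ) : ℝ)) := by
  set S : ℕ := univ.sup fun i => (b i).natAbs with hS
  rcases le_or_gt S 2 with h2 | h2
  · have hB : stewartB b = 2 := by
      show max 2 S = 2
      exact max_eq_left h2
    rw [hB]
    have hlog2 : Real.log 2 < 0.6931471808 := Real.log_two_lt_d9
    have : Real.log ((2 : ℕ) : ℝ) = Real.log 2 := by norm_num
    rw [this]
    exact le_max_of_le_left (by linarith)
  · have hB : stewartB b = S := by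
      show max 2 S = S
      exact max_eq_right h2.le
    rw [hB]
    exact le_max_right _ _

/-- `G₁^ℚ(n) ≤ 13 n²` for `n ≥ 2` (from `G₁^ℚ(n) ≤ 1.53 (n+1) 5.4n = 8.262 n(n+1)`); this is the
`d = 1` case of "`max{log⁺B, (k+1)(5.4k + log d)} ≤ 13k² log⁺d · log⁺B`" of [BiluGunHong2022]
with Yu's published `G₁(n,1)` in place of `(k+1) · 5.4k` (for `n = 1` one has instead
`(n+1) · 5.4n = 10.8 ≤ 13`, used below through the proved one-logarithm case).
[cite: BiluGunHong2022, proof of Theorem 3.1; Yu2013, (1.11), (1.30)–(1.31)] -/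
theorem yuG1Rat_le_thirteen_sq {n : ℕ} (hn : 2 ≤ n) : yuG1Rat n ≤ 13 * (n : ℝ) ^ 2 := by
  have h := yuG1Rat_le_d153 hn
  have hnR : (2 : ℝ) ≤ n := by exact_mod_cast hn
  have hkey : 1.53 * (((n : ℝ) + 1) * (5.4 * n)) ≤ 13 * (n : ℝ) ^ 2 := by nlinarith
  linarith

/-- **[BiluGunHong2022, Theorem 3.1] over `ℚ` for at most one logarithm, unconditionally.** For
`n ≤ 1` the uniform bound below holds outright, from the proved one-logarithm case of Stewart's
Lemma 5 (`Stewart2013_lemma5_rat_of_le_one`, printed form, `(n+1) · 5.4n = 10.8 ≤ 13 n²`) and the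
arithmetic of [BiluGunHong2022, proof of Theorem 3.1] (`bhg_uniform_engine`). See
`Stewart2013_lemma5_rat.uniform` for the statement and its provenance.
[cite: BiluGunHong2022, Theorem 3.1 (K = ℚ, k ≤ 1)] [cite: Stewart2013, Lemma 3.1] -/
theorem Stewart2013_lemma5_rat_uniform_of_le_one (n p : ℕ) (hn : n ≤ 1) (α : Fin n → ℚ)
    (b : Fin n → ℤ) (δ : ℝ) (hp : p.Prime) (hp5 : 5 ≤ p)
    (hα : ∀ i, α i ≠ 0 ∧ padicValRat p (α i) = 0)
    (hind : ∀ e : Fin n → ℤ, ∏ i, α i ^ e i = 1 → e = 0) (hb : b ≠ 0)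
    (hδ0 : 0 < δ) (hδ : δ ≤ stewartDelta p α) :
    (padicValRat p (∏ i, α i ^ b i - 1) : ℝ) ≤
      10 ^ 5 * 30 ^ n * (n : ℝ) ^ ((5 : ℝ) / 2) * max 1 (Real.log n) *
        (∏ i, logHeight₁ (α i)) *
        max ((p : ℝ) / δ * ((n : ℝ) / Real.log p) ^ n) (Real.exp n * Real.log p) *
        max 1 (Real.log ((univ.sup fun i => (b i).natAbs : ℕ) : ℝ)) := by
  obtain rfl | rfl : n = 0 ∨ n = 1 := by omega
  · exact absurd (Subsingleton.elim b 0) hb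
  · have hv := Stewart2013_lemma5_rat_of_le_one 1 p le_rfl α b hp hp5 hα hind hb
    have hG : (((1 : ℕ) : ℝ) + 1) * (5.4 * ((1 : ℕ) : ℝ)) ≤ 13 * (((1 : ℕ) : ℝ)) ^ 2 := by
      norm_num
    have hH : 0 ≤ ∏ i, logHeight₁ (α i) := prod_nonneg fun i _ => zero_le_logHeight₁ _
    exact bhg_uniform_engine le_rfl hp5 hδ0 hδ hH hG (two_le_stewartB b) (log_stewartB_le b)
      (le_max_left _ _) hv

/-- **[BiluGunHong2022, Theorem 3.1], case `K = ℚ`, from the named fact `Stewart2013_lemma5_rat`.**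
Yu. Bilu, H. Hong and S. Gun, *Uniform explicit Stewart's theorem on prime factors of linear
recurrences*, arXiv:2108.09857 = Acta Arith. (2023), Theorem 3.1 ("our principal tool", "a
simplification (with slightly bigger numerical constants) of [St13], which, on its own, is a
simplification of the main theorem of [Yu13]"), specialised to `K = ℚ`: `d = 1` (so
`d^{k+2}(log⁺d)³ = 1`), `𝔭 = p ≥ 5`, `N𝔭 = p`, `ζ = -1` (`u = 1`). For multiplicatively
independent `p`-adic units `α₁, …, αₙ ∈ ℚ`, integers `b₁, …, bₙ` not all zero, `B = max |bᵢ|`,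
`log⁺ = max(log, 1)`, and a real `δ` with `0 < δ ≤ δ_S`:
`ν_p(α₁^{b₁}⋯αₙ^{bₙ} − 1) ≤ 10⁵ · 30ⁿ n^{5/2} log⁺n · h(α₁)⋯h(αₙ) · Ω · log⁺B`,
`Ω = max(p δ⁻¹ (n/log p)ⁿ, eⁿ log p)`.
Here `δ_S = stewartDelta p α` is Stewart's `δ` ((16) = (3.1): the index
`[𝔽_pˣ : ⟨-1, ᾱ₁, …, ᾱₙ⟩]` if `[ℚ(√-1, √α₁, …, √αₙ) : ℚ] = 2^{n+1}`, and `1` otherwise). The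
printed Theorem 3.1 words the first alternative as "`[K(α₁^{1/2}, …, α_k^{1/2}) : K] = 2^k`",
without `ζ^{1/2}`; that clause is not the one of [Stewart2013, (3.1)] / [Yu2013, (1.7)] from which
the theorem is quoted (over `ℚ`, `α₁ = -4` satisfies it but not Stewart's), and [BiluGunHong2022]
only ever applies the theorem with `δ = 1` (§4), so the theorem is vendored here with Stewart's
`δ`, exactly as it follows from Lemma 3.1. Positivity of `δ` is implicit in the source.
*Proof* (ibid., p. 5): `√(k+1) ≤ √2 √k`, `7e(p−1)/(p−2) ≤ 28e/3 (≤ 30)`,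
`log(e⁴(k+1)) ≤ 8 log⁺k`, `max{log⁺B, G} ≤ 13k² log⁺B` and `376 · 104 √2 < 10⁵`
(`bhg_uniform_engine`); over `ℚ` the `G` of the named fact is Yu's `G₁(n,1) ≤ 13n²` for `n ≥ 2`
(`yuG1Rat_le_thirteen_sq`), and for `n ≤ 1` the bound is unconditional
(`Stewart2013_lemma5_rat_uniform_of_le_one`). In particular the 2026-08-15 restatement of the
named fact (module docstring of `StewartYuPadicLogForms.lean`) costs this downstream form nothing.
[cite: BiluGunHong2022, Theorem 3.1 (K = ℚ)] [cite: Stewart2013, Lemma 3.1]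
[cite: Yu2013, Main Theorem, §1.3 case (III.2)] -/
theorem Stewart2013_lemma5_rat.uniform (h : Stewart2013_lemma5_rat) (n p : ℕ) (α : Fin n → ℚ)
    (b : Fin n → ℤ) (δ : ℝ) (hp : p.Prime) (hp5 : 5 ≤ p)
    (hα : ∀ i, α i ≠ 0 ∧ padicValRat p (α i) = 0)
    (hind : ∀ e : Fin n → ℤ, ∏ i, α i ^ e i = 1 → e = 0) (hb : b ≠ 0)
    (hδ0 : 0 < δ) (hδ : δ ≤ stewartDelta p α) :
    (padicValRat p (∏ i, α i ^ b i - 1) : ℝ) ≤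
      10 ^ 5 * 30 ^ n * (n : ℝ) ^ ((5 : ℝ) / 2) * max 1 (Real.log n) *
        (∏ i, logHeight₁ (α i)) *
        max ((p : ℝ) / δ * ((n : ℝ) / Real.log p) ^ n) (Real.exp n * Real.log p) *
        max 1 (Real.log ((univ.sup fun i => (b i).natAbs : ℕ) : ℝ)) := by
  rcases Nat.lt_or_ge n 2 with hn | hn
  · exact Stewart2013_lemma5_rat_uniform_of_le_one n p (by omega) α b δ hp hp5 hα hind hb hδ0 hδ
  · have hv := h n p α b hp hp5 hα hind hb
    have hH : 0 ≤ ∏ i, logHeight₁ (α i) := prod_nonneg fun i _ => zero_le_logHeight₁ _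
    exact bhg_uniform_engine (by omega) hp5 hδ0 hδ hH (yuG1Rat_le_thirteen_sq hn)
      (two_le_stewartB b) (log_stewartB_le b) (le_max_left _ _) hv

/-- The `δ = 1` instance of `Stewart2013_lemma5_rat.uniform` (the shape applied in
[BiluGunHong2022, §4]: `Ω = max(p (n/log p)ⁿ, eⁿ log p)`).
[cite: BiluGunHong2022, Theorem 3.1 and §4 (δ = 1)] -/
theorem Stewart2013_lemma5_rat.uniform_delta_one (h : Stewart2013_lemma5_rat) (n p : ℕ)
    (α : Fin n → ℚ) (b : Fin n → ℤ) (hp : p.Prime) (hp5 : 5 ≤ p)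
    (hα : ∀ i, α i ≠ 0 ∧ padicValRat p (α i) = 0)
    (hind : ∀ e : Fin n → ℤ, ∏ i, α i ^ e i = 1 → e = 0) (hb : b ≠ 0) :
    (padicValRat p (∏ i, α i ^ b i - 1) : ℝ) ≤
      10 ^ 5 * 30 ^ n * (n : ℝ) ^ ((5 : ℝ) / 2) * max 1 (Real.log n) *
        (∏ i, logHeight₁ (α i)) *
        max ((p : ℝ) * ((n : ℝ) / Real.log p) ^ n) (Real.exp n * Real.log p) *
        max 1 (Real.log ((univ.sup fun i => (b i).natAbs : ℕ) : ℝ)) := by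
  have := h.uniform n p α b 1 hp hp5 hα hind hb one_pos (one_le_stewartDelta hp (fun i => hα i))
  simpa only [div_one] using this

/-! ### §Y1. Multiplicatively independent rationals involve many primes (replaces Loher–Masser over `ℚ`) -/

/-- `ord_ℓ` of a finite product of non-zero rationals. [folklore] -/
theorem padicValRat_prod_univ {ι : Type*} [Fintype ι] (ℓ : ℕ) [Fact ℓ.Prime] (f : ι → ℚ)
    (hf : ∀ i, f i ≠ 0) : padicValRat ℓ (∏ i, f i) = ∑ i, padicValRat ℓ (f i) := by
  classical
  induction (univ : Finset ι) using Finset.induction_on with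
  | empty => simp
  | insert a s has ih =>
    rw [Finset.prod_insert has, Finset.sum_insert has,
      padicValRat.mul (hf a) (Finset.prod_ne_zero_iff.mpr fun i _ => hf i), ih]

/-- A non-zero rational all of whose `ℓ`-adic orders vanish is `±1`. [folklore] -/
theorem eq_one_or_eq_neg_one_of_padicValRat_eq_zero {x : ℚ} (hx : x ≠ 0)
    (h : ∀ ℓ : ℕ, ℓ.Prime → padicValRat ℓ x = 0) : x = 1 ∨ x = -1 := by
  have hden : x.den = 1 := by
    by_contra hd
    set ℓ := x.den.minFac with hℓ
    have hℓp : ℓ.Prime := Nat.minFac_prime hd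
    haveI := Fact.mk hℓp
    have hdvd : ℓ ∣ x.den := Nat.minFac_dvd _
    have hnum : ¬ (ℓ : ℤ) ∣ x.num := by
      intro hz
      have hc : Nat.Coprime x.num.natAbs x.den := x.reduced
      have h1 : ℓ ∣ x.num.natAbs := Int.natCast_dvd.mp hz
      have : ℓ ∣ Nat.gcd x.num.natAbs x.den := Nat.dvd_gcd h1 hdvd
      rw [hc] at this
      exact hℓp.one_lt.ne' (Nat.dvd_one.mp this)
    have hv := h ℓ hℓp
    rw [padicValRat_def, padicValInt.eq_zero_of_not_dvd hnum] at hv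
    have hpos : 0 < padicValNat ℓ x.den :=
      one_le_padicValNat_of_dvd (x.den_pos.ne') hdvd
    omega
  have hnum : x.num.natAbs = 1 := by
    by_contra hn
    set ℓ := x.num.natAbs.minFac with hℓ
    have hℓp : ℓ.Prime := Nat.minFac_prime hn
    haveI := Fact.mk hℓp
    have hdvd : ℓ ∣ x.num.natAbs := Nat.minFac_dvd _
    have hv := h ℓ hℓp
    have h10 : padicValNat ℓ 1 = 0 := by simp
    rw [padicValRat_def, hden, h10, Nat.cast_zero, sub_zero] at hv
    have hz : (ℓ : ℤ) ∣ x.num := Int.natCast_dvd.mpr hdvd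
    have hne : x.num ≠ 0 := Rat.num_ne_zero.mpr hx
    have hpos : 0 < padicValInt ℓ x.num := by
      rw [padicValInt]
      exact one_le_padicValNat_of_dvd (Int.natAbs_ne_zero.mpr hne) hdvd
    omega
  have hx' : x = (x.num : ℚ) := by
    conv_lhs => rw [← Rat.num_div_den x, hden]
    simp
  rcases Int.natAbs_eq x.num with hpos | hneg
  · left; rw [hx', hpos, hnum]; simp
  · right; rw [hx', hneg, hnum]; simp

/-- **`m` multiplicatively independent non-zero rationals involve at least `m` primes** (in
their numerators and denominators): the exponent map `e ↦ (ord_ℓ ∏ βᵢ^{eᵢ})_ℓ` is an injective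
`ℤ`-linear map `ℤ^m → ℤ^S`, `S` the set of primes involved. Over `ℚ` this replaces the
Loher–Masser counting theorem used in [Yu2013, §8]. [folklore] -/
theorem le_card_primeSupport {m : ℕ} (β : Fin m → ℚ) (hβ : ∀ i, β i ≠ 0)
    (hind : ∀ e : Fin m → ℤ, ∏ i, β i ^ e i = 1 → e = 0) :
    m ≤ (univ.biUnion fun i => (β i).num.natAbs.primeFactors ∪ (β i).den.primeFactors).card := by
  classical
  set S := univ.biUnion fun i => (β i).num.natAbs.primeFactors ∪ (β i).den.primeFactors with hS
  -- valuations outside `S` vanish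
  have hout : ∀ ℓ : ℕ, ℓ.Prime → ℓ ∉ S → ∀ i, padicValRat ℓ (β i) = 0 := by
    intro ℓ hℓ hℓS i
    haveI := Fact.mk hℓ
    have hi : ℓ ∉ (β i).num.natAbs.primeFactors ∪ (β i).den.primeFactors := by
      intro hmem
      exact hℓS (Finset.mem_biUnion.mpr ⟨i, mem_univ _, hmem⟩)
    rw [Finset.mem_union, not_or, Nat.mem_primeFactors, Nat.mem_primeFactors] at hi
    have hn0 : (β i).num.natAbs ≠ 0 := Int.natAbs_ne_zero.mpr (Rat.num_ne_zero.mpr (hβ i))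
    have h1 : ¬ ℓ ∣ (β i).num.natAbs := fun hd => hi.1 ⟨hℓ, hd, hn0⟩
    have h2 : ¬ ℓ ∣ (β i).den := fun hd => hi.2 ⟨hℓ, hd, (β i).den_pos.ne'⟩
    rw [padicValRat_def, padicValInt.eq_zero_of_not_dvd (fun hz => h1 (Int.natCast_dvd.mp hz)),
      padicValNat.eq_zero_of_not_dvd h2]
    simp
  -- the linear map
  let f : (Fin m → ℤ) →ₗ[ℤ] (↥S → ℤ) :=
    { toFun := fun e ℓ => ∑ i, e i * padicValRat (ℓ : ℕ) (β i)
      map_add' := by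
        intro e e'
        ext ℓ
        simp only [Pi.add_apply, add_mul, Finset.sum_add_distrib]
      map_smul' := by
        intro c e
        ext ℓ
        simp only [Pi.smul_apply, smul_eq_mul, RingHom.id_apply, Finset.mul_sum, mul_assoc] }
  have hf : Function.Injective f := by
    rw [injective_iff_map_eq_zero]
    intro e he
    -- `x = ∏ βᵢ^{eᵢ}` has all valuations zero
    set x := ∏ i, β i ^ e i with hx
    have hx0 : x ≠ 0 := Finset.prod_ne_zero_iff.mpr fun i _ => zpow_ne_zero _ (hβ i)
    have hval : ∀ ℓ : ℕ, ℓ.Prime → padicValRat ℓ x = ∑ i, e i * padicValRat ℓ (β i) := by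
      intro ℓ hℓ
      haveI := Fact.mk hℓ
      rw [hx, padicValRat_prod_univ ℓ _ fun i => zpow_ne_zero _ (hβ i)]
      simp [padicValRat.zpow]
    have hzero : ∀ ℓ : ℕ, ℓ.Prime → padicValRat ℓ x = 0 := by
      intro ℓ hℓ
      rw [hval ℓ hℓ]
      by_cases hℓS : ℓ ∈ S
      · have := congr_fun he ⟨ℓ, hℓS⟩
        change (∑ i, e i * padicValRat ℓ (β i)) = 0 at this
        exact this
      · simp [hout ℓ hℓ hℓS]
    have hx1 : x = 1 ∨ x = -1 := eq_one_or_eq_neg_one_of_padicValRat_eq_zero hx0 hzero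
    have hsq : ∏ i, β i ^ ((2 : ℤ) • e) i = 1 := by
      have : ∏ i, β i ^ ((2 : ℤ) • e) i = x ^ 2 := by
        rw [hx, ← Finset.prod_pow]
        refine Finset.prod_congr rfl fun i _ => ?_
        rw [Pi.smul_apply, smul_eq_mul, ← zpow_natCast, ← zpow_mul, mul_comm]
        norm_num
      rw [this]
      rcases hx1 with h1 | h1 <;> rw [h1] <;> norm_num
    have h2e := hind _ hsq
    funext i
    have := congr_fun h2e i
    simp only [Pi.smul_apply, smul_eq_mul, Pi.zero_apply, mul_eq_zero,
      OfNat.ofNat_ne_zero, false_or] at this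
    simpa using this
  have hrank := LinearMap.finrank_le_finrank_of_injective (f := f) hf
  rw [Module.finrank_fin_fun, Module.finrank_fintype_fun_eq_card, Fintype.card_coe] at hrank
  exact hrank


/-- Among `m + 1` multiplicatively independent non-zero rationals one has height `≥ log(m+2)`:
they involve `≥ m + 1` primes, not all `≤ m + 1` (there are at most `m` of those), and a prime
`ℓ` dividing the numerator or denominator of `β` forces `h(β) = log max(|num|, den) ≥ log ℓ`.
[folklore] -/
theorem exists_log_le_logHeight₁ {m : ℕ} (β : Fin (m + 1) → ℚ) (hβ : ∀ i, β i ≠ 0)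
    (hind : ∀ e : Fin (m + 1) → ℤ, ∏ i, β i ^ e i = 1 → e = 0) :
    ∃ i, Real.log ((m : ℝ) + 2) ≤ logHeight₁ (β i) := by
  classical
  set S := univ.biUnion fun i => (β i).num.natAbs.primeFactors ∪ (β i).den.primeFactors with hS
  have hcard : m + 1 ≤ S.card := le_card_primeSupport β hβ hind
  -- some prime in `S` is `≥ m + 2`
  have hbig : ∃ ℓ ∈ S, m + 2 ≤ ℓ := by
    by_contra hno
    push Not at hno
    have hsub : S ⊆ Finset.Icc 2 (m + 1) := by
      intro ℓ hℓ
      have hprime : ℓ.Prime := by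
        obtain ⟨i, -, hi⟩ := Finset.mem_biUnion.mp hℓ
        rcases Finset.mem_union.mp hi with h | h <;> exact Nat.prime_of_mem_primeFactors h
      exact Finset.mem_Icc.mpr ⟨hprime.two_le, by have := hno ℓ hℓ; omega⟩
    have := Finset.card_le_card hsub
    rw [Nat.card_Icc] at this
    omega
  obtain ⟨ℓ, hℓS, hℓ⟩ := hbig
  obtain ⟨i, -, hi⟩ := Finset.mem_biUnion.mp hℓS
  refine ⟨i, ?_⟩
  have hn0 : (β i).num.natAbs ≠ 0 := Int.natAbs_ne_zero.mpr (Rat.num_ne_zero.mpr (hβ i))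
  have hle : ℓ ≤ max (β i).num.natAbs (β i).den := by
    rcases Finset.mem_union.mp hi with h | h
    · exact le_trans (Nat.le_of_dvd (Nat.pos_of_ne_zero hn0) (Nat.dvd_of_mem_primeFactors h))
        (le_max_left _ _)
    · exact le_trans (Nat.le_of_dvd (β i).den_pos (Nat.dvd_of_mem_primeFactors h))
        (le_max_right _ _)
  rw [Rat.logHeight₁_eq_log_max]
  have hcast : ((m : ℝ) + 2) ≤ ((max (β i).num.natAbs (β i).den : ℕ) : ℝ) := by
    have : m + 2 ≤ max (β i).num.natAbs (β i).den := le_trans hℓ hle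
    exact_mod_cast this
  exact Real.log_le_log (by positivity) hcast

/-- A sub-family (one index removed) of a multiplicatively independent family is
multiplicatively independent. [folklore] -/
theorem multIndep_succAbove {m : ℕ} {β : Fin (m + 1) → ℚ}
    (hind : ∀ e : Fin (m + 1) → ℤ, ∏ i, β i ^ e i = 1 → e = 0) (k : Fin (m + 1)) :
    ∀ e : Fin m → ℤ, ∏ j, β (k.succAbove j) ^ e j = 1 → e = 0 := by
  intro e he
  set E : Fin (m + 1) → ℤ := Fin.insertNth k 0 e with hE
  have hfull : ∏ i, β i ^ E i = 1 := by
    rw [Fin.prod_univ_succAbove _ k, hE, Fin.insertNth_apply_same, zpow_zero, one_mul]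
    simp only [Fin.insertNth_apply_succAbove]
    exact he
  have h0 := hind E hfull
  funext j
  have := congr_fun h0 (k.succAbove j)
  rw [hE, Fin.insertNth_apply_succAbove] at this
  exact this

/-- **The product of the heights of `m` multiplicatively independent rationals is at least
`log 2 · log 3 ⋯ log(m+1)`** (remove an element of largest height, which is `≥ log(m+1)` by
`exists_log_le_logHeight₁`, and induct). Over `ℚ` this is the input that [Yu2013, §8] draws
from Loher–Masser [14, Theorem 3]. [folklore] -/
theorem prod_log_le_prod_logHeight₁ :
    ∀ {m : ℕ} (β : Fin m → ℚ), (∀ i, β i ≠ 0) →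
      (∀ e : Fin m → ℤ, ∏ i, β i ^ e i = 1 → e = 0) →
      ∏ j : Fin m, Real.log ((j : ℕ) + 2 : ℝ) ≤ ∏ i, logHeight₁ (β i) := by
  intro m
  induction m with
  | zero => intro β _ _; simp
  | succ m ih =>
    intro β hβ hind
    obtain ⟨k, hk⟩ := exists_log_le_logHeight₁ β hβ hind
    have hsub := ih (fun j => β (k.succAbove j)) (fun j => hβ _) (multIndep_succAbove hind k)
    rw [Fin.prod_univ_succAbove (fun i => logHeight₁ (β i)) k, Fin.prod_univ_castSucc]
    have hlog0 : ∀ j : Fin m, 0 ≤ Real.log (((Fin.castSucc j : Fin (m + 1)) : ℕ) + 2 : ℝ) :=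
      fun j => Real.log_nonneg (by have : (0:ℝ) ≤ ((Fin.castSucc j : Fin (m+1)) : ℕ) := Nat.cast_nonneg _; linarith)
    have hcast : ∏ j : Fin m, Real.log (((Fin.castSucc j : Fin (m + 1)) : ℕ) + 2 : ℝ) =
        ∏ j : Fin m, Real.log ((j : ℕ) + 2 : ℝ) := by
      refine Finset.prod_congr rfl fun j _ => ?_
      simp
    rw [hcast, mul_comm]
    have hlast : Real.log (((Fin.last m : Fin (m + 1)) : ℕ) + 2 : ℝ) = Real.log ((m : ℝ) + 2) := by
      simp
    rw [hlast]
    apply mul_le_mul hk hsub (Finset.prod_nonneg fun j _ => Real.log_nonneg ?_) (zero_le_logHeight₁ _)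
    have : (0:ℝ) ≤ ((j : ℕ) : ℝ) := Nat.cast_nonneg _
    linarith


/-! ### §Y2. Numerical lemmas for the Liouville branch of [Yu2013, Lemma 8.1] over `ℚ` -/

/-- `e⁶ < 403.5` (`e < 2.7182818286`). [folklore] -/
theorem exp_six_lt : Real.exp 6 < 403.5 := by
  have h : Real.exp 6 = Real.exp 1 ^ 6 := by
    rw [← Real.exp_nat_mul]; norm_num
  rw [h]
  have he := Real.exp_one_lt_d9
  have he0 : 0 ≤ Real.exp 1 := (Real.exp_pos 1).le
  calc Real.exp 1 ^ 6 < 2.7182818286 ^ 6 := by gcongr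
    _ < 403.5 := by norm_num

/-- Stewart's `C ≥ 1504 · √(n+1) · (7e)ⁿ eⁿ · log p` (keep `√(n+1)`, use `(p−1)/(p−2) ≥ 1`,
`log(e⁴(n+1)) ≥ 4` and the second term of the maximum). [cite: Stewart2013, Lemma 5] -/
theorem stewartC_ge_sqrt (n : ℕ) {p : ℕ} (hp5 : 5 ≤ p) (δ : ℝ) :
    1504 * Real.sqrt (n + 1) * ((7 * Real.exp 1) ^ n * Real.exp 1 ^ n) * Real.log p ≤
      stewartC n p δ := by
  have hp' : (5 : ℝ) ≤ p := by exact_mod_cast hp5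
  have hL : 0 < Real.log p := Real.log_pos (by linarith)
  have hE : 0 < Real.exp 1 := Real.exp_pos 1
  have hfrac : (1 : ℝ) ≤ ((p : ℝ) - 1) / ((p : ℝ) - 2) := by
    rw [le_div_iff₀ (by linarith)]
    linarith
  have hpow : (7 * Real.exp 1) ^ n ≤ (7 * Real.exp 1 * (((p : ℝ) - 1) / ((p : ℝ) - 2))) ^ n :=
    pow_le_pow_left₀ (by positivity) (le_mul_of_one_le_right (by positivity) hfrac) n
  have hlog : (4 : ℝ) ≤ Real.log (Real.exp 4 * (n + 1)) := by
    rw [Real.log_mul (Real.exp_pos 4).ne' (by positivity), Real.log_exp]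
    have : (0 : ℝ) ≤ Real.log (n + 1) :=
      Real.log_nonneg (by have : (0:ℝ) ≤ n := Nat.cast_nonneg n; linarith)
    linarith
  have hmax : Real.exp 1 ^ n * Real.log p ≤
      max ((p : ℝ) / δ * ((n : ℝ) / Real.log p) ^ n) (Real.exp n * Real.log p) := by
    rw [Real.exp_one_pow]
    exact le_max_right _ _
  have hs0 : 0 ≤ Real.sqrt (n + 1) := Real.sqrt_nonneg _
  rw [stewartC_def]
  calc 1504 * Real.sqrt (n + 1) * ((7 * Real.exp 1) ^ n * Real.exp 1 ^ n) * Real.log p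
      = 376 * Real.sqrt (n + 1) * (7 * Real.exp 1) ^ n * 4 * (Real.exp 1 ^ n * Real.log p) := by
        ring
    _ ≤ 376 * Real.sqrt (n + 1) * (7 * Real.exp 1 * (((p : ℝ) - 1) / ((p : ℝ) - 2))) ^ n *
          Real.log (Real.exp 4 * (n + 1)) *
          max ((p : ℝ) / δ * ((n : ℝ) / Real.log p) ^ n) (Real.exp n * Real.log p) := by
        gcongr

/-- `B_S = max(2, |bᵢ|) ≤ B` whenever `B ≥ 2` bounds all `|bᵢ|`. [folklore] -/
theorem stewartB_le_of {n : ℕ} (b : Fin n → ℤ) {B : ℝ} (h2 : 2 ≤ B)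
    (hb : ∀ i, ((b i).natAbs : ℝ) ≤ B) : ((stewartB b : ℕ) : ℝ) ≤ B := by
  have hsup : (((univ : Finset (Fin n)).sup fun i => (b i).natAbs : ℕ) : ℝ) ≤ B := by
    rcases (univ : Finset (Fin n)).eq_empty_or_nonempty with h | h
    · rw [h, Finset.sup_empty]
      simp only [bot_eq_zero, CharP.cast_eq_zero]
      linarith
    · obtain ⟨i, -, hi⟩ := Finset.exists_mem_eq_sup _ h fun i => (b i).natAbs
      rw [hi]
      exact hb i
  show ((max 2 ((univ : Finset (Fin n)).sup fun i => (b i).natAbs) : ℕ) : ℝ) ≤ B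
  rw [Nat.cast_max]
  exact max_le (by exact_mod_cast h2) hsup

/-- `2 (0.6931)³ (1.6089)ᵏ ≤ log 2 · log 3 ⋯ log(k+4)` (`log 3 ≥ log 2`, `log 4 = 2 log 2`,
`log j ≥ log 5 > 1.6089` for `j ≥ 5`). [folklore] -/
theorem prod_log_ge_geom (k : ℕ) :
    2 * 0.6931 ^ 3 * 1.6089 ^ k ≤ ∏ j : Fin (k + 3), Real.log ((j : ℕ) + 2 : ℝ) := by
  have hlog2 : (0.6931 : ℝ) < Real.log 2 := lt_trans (by norm_num) Real.log_two_gt_d9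
  have hlog5 : (1.6089 : ℝ) < Real.log 5 := log_five_gt_d4
  induction k with
  | zero =>
    rw [Fin.prod_univ_three]
    simp only [Fin.val_zero, CharP.cast_eq_zero, zero_add, Fin.val_one, Nat.cast_one, Fin.val_two,
      Nat.cast_ofNat, pow_zero, mul_one]
    have h3 : Real.log 2 ≤ Real.log ((1 : ℝ) + 2) := Real.log_le_log (by norm_num) (by norm_num)
    have h4 : Real.log ((2 : ℝ) + 2) = 2 * Real.log 2 := by
      rw [show ((2 : ℝ) + 2) = 2 ^ 2 by norm_num, Real.log_pow]; norm_num
    rw [h4]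
    have h2' : (0.6931 : ℝ) ≤ Real.log 2 := hlog2.le
    have hA : 0.6931 * 0.6931 ≤ Real.log 2 * Real.log ((1 : ℝ) + 2) :=
      mul_le_mul h2' (le_trans h2' h3) (by norm_num) (by linarith)
    nlinarith [mul_le_mul hA h2' (by norm_num) (by nlinarith)]
  | succ k ih =>
    rw [Fin.prod_univ_castSucc]
    simp only [Fin.val_castSucc, Fin.val_last]
    have hlast : (1.6089 : ℝ) ≤ Real.log (((k + 3 : ℕ) : ℝ) + 2) := by
      have : Real.log 5 ≤ Real.log (((k + 3 : ℕ) : ℝ) + 2) :=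
        Real.log_le_log (by norm_num) (by push_cast; linarith)
      linarith
    calc 2 * 0.6931 ^ 3 * (1.6089 : ℝ) ^ (k + 1) = (2 * 0.6931 ^ 3 * 1.6089 ^ k) * 1.6089 := by
          ring
      _ ≤ (∏ j : Fin (k + 3), Real.log ((j : ℕ) + 2 : ℝ)) * Real.log (((k + 3 : ℕ) : ℝ) + 2) :=
          mul_le_mul ih hlast (by norm_num) (le_trans (by positivity) ih)

/-- **The numerical inequality of the Liouville branch**: for every `m ≥ 0`,
`403.5 (m+1)(3.95 m + 9.79) + 1 < 6263.7 (m+2) √(m+2) · log 2 · log 3 ⋯ log(m+1)`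
(the empty product for `m = 0`; `log 2 > 0.6931`, `log 3 ≥ log 2`, `log 4 = 2 log 2`,
`log j ≥ log 5 > 1.6089` for `j ≥ 5` and Bernoulli's inequality). [folklore] -/
theorem yu93_numeric (m : ℕ) :
    403.5 * ((m : ℝ) + 1) * (3.95 * m + 9.79) + 1 <
      6263.7 * ((m : ℝ) + 2) * Real.sqrt ((m : ℝ) + 2) * ∏ j : Fin m, Real.log ((j : ℕ) + 2 : ℝ) := by
  have hlog2 : (0.6931 : ℝ) < Real.log 2 := lt_trans (by norm_num) Real.log_two_gt_d9
  rcases Nat.lt_or_ge m 3 with hm | hm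
  · interval_cases m
    · -- m = 0
      simp only [CharP.cast_eq_zero, zero_add, mul_zero, Finset.univ_eq_empty, Finset.prod_empty,
        mul_one]
      have hs : (1.4142 : ℝ) < Real.sqrt 2 := by
        rw [Real.lt_sqrt (by norm_num)]; norm_num
      nlinarith
    · -- m = 1
      rw [Fin.prod_univ_one]
      simp only [Nat.cast_one, Fin.val_zero, CharP.cast_eq_zero, zero_add]
      have hs : (1.732 : ℝ) < Real.sqrt ((1 : ℝ) + 2) := by
        rw [Real.lt_sqrt (by norm_num)]; norm_num
      have hprod : 1.732 * 0.6931 ≤ Real.sqrt ((1 : ℝ) + 2) * Real.log 2 :=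
        mul_le_mul hs.le hlog2.le (by norm_num) (Real.sqrt_nonneg _)
      nlinarith
    · -- m = 2
      rw [Fin.prod_univ_two]
      simp only [Nat.cast_ofNat, Fin.val_zero, CharP.cast_eq_zero, zero_add, Fin.val_one,
        Nat.cast_one]
      have hs : Real.sqrt ((2 : ℝ) + 2) = 2 := by
        rw [show ((2 : ℝ) + 2) = 2 ^ 2 by norm_num, Real.sqrt_sq (by norm_num)]
      rw [hs]
      have h3 : Real.log 2 ≤ Real.log ((1 : ℝ) + 2) := Real.log_le_log (by norm_num) (by norm_num)
      have hprod : 0.6931 * 0.6931 ≤ Real.log 2 * Real.log ((1 : ℝ) + 2) :=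
        mul_le_mul hlog2.le (le_trans hlog2.le h3) (by norm_num) (by linarith)
      nlinarith
  · obtain ⟨k, rfl⟩ : ∃ k, m = k + 3 := ⟨m - 3, by omega⟩
    have hk0 : (0 : ℝ) ≤ k := Nat.cast_nonneg k
    have hB : (1 : ℝ) + k * 0.6089 ≤ (1.6089 : ℝ) ^ k := by
      have := one_add_mul_le_pow (show (-2 : ℝ) ≤ 0.6089 by norm_num) k
      norm_num at this ⊢
      exact this
    have hP : 2 * 0.6931 ^ 3 * (1 + k * 0.6089) ≤ ∏ j : Fin (k + 3), Real.log ((j : ℕ) + 2 : ℝ) :=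
      le_trans (mul_le_mul_of_nonneg_left hB (by norm_num)) (prod_log_ge_geom k)
    push_cast
    have hs : (2.236 : ℝ) ≤ Real.sqrt ((k : ℝ) + 3 + 2) :=
      (Real.le_sqrt (by norm_num) (by linarith)).mpr (by nlinarith)
    have hX : 2.236 * (2 * 0.6931 ^ 3 * (1 + k * 0.6089)) ≤
        Real.sqrt ((k : ℝ) + 3 + 2) * ∏ j : Fin (k + 3), Real.log ((j : ℕ) + 2 : ℝ) :=
      mul_le_mul hs hP (by nlinarith) (Real.sqrt_nonneg _)
    have hY := mul_le_mul_of_nonneg_left hX (show (0 : ℝ) ≤ 6263.7 * ((k : ℝ) + 3 + 2) by nlinarith)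
    have hring : 6263.7 * ((k : ℝ) + 3 + 2) *
        (Real.sqrt ((k : ℝ) + 3 + 2) * ∏ j : Fin (k + 3), Real.log ((j : ℕ) + 2 : ℝ)) =
        6263.7 * ((k : ℝ) + 3 + 2) * Real.sqrt ((k : ℝ) + 3 + 2) *
          ∏ j : Fin (k + 3), Real.log ((j : ℕ) + 2 : ℝ) := by ring
    rw [hring] at hY
    nlinarith [hY, hk0]


/-! ### §Y3. Yu's Lemma 9.3 over `ℚ` from a bound of the shape of the named fact -/

/-- **Engine of [Yu2013, Lemma 9.3] over `ℚ`** (the Liouville dichotomy of [Yu2013, Lemma 8.1]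
with explicit margins, plus the trivial branch). Let `n ≥ 1`, `p ≥ 5`, `α` multiplicatively
independent `p`-adic units, `b ≠ 0`, `B ≥ max(|bᵢ|, 5)`, and suppose a bound of the shape of the
named fact, `ord_p(Ξ − 1) < C · ∏h · max(log B_S, G)` with `C = stewartC n p δ` and any
`G ≤ G₁^ℚ(n)`. Then `ord_p(Ξ − 1) < (n+1) · C · ∏h · log B`. Indeed, if `G ≤ (n+1) log B` this
is immediate; otherwise `log B < G₁^ℚ(n)/(n+1)`, i.e. `B < e^{a₀n + a₁}(a₀ n + a₁) ≤ 403.5 (7e²)ⁿ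
(3.95 n + 5.84)` (`a₀ = 2 + log 7`, `a₁ = 5.84`), and the Liouville bound
`ord_p(Ξ − 1) log p ≤ log 2 + B ∑ h(αᵢ) ≤ h_max (1 + n B)` is already smaller than
`(n+1) C ∏h log B · log p ≥ 1504 (log 5)³ (n+1)^{3/2} (7e²)ⁿ h_max · log 2 ⋯ log n` — the product
of the other `n − 1` heights being `≥ log 2 ⋯ log n` (`prod_log_le_prod_logHeight₁`, in place of
Loher–Masser) and `403.5 n (3.95n + 5.84) + 1 < 6263.7 (n+1)^{3/2} log 2 ⋯ log n`
(`yu93_numeric`). [cite: Yu2013, Lemma 9.3 and its proof via Theorem 1, Lemma 8.1 ((8.2)–(8.5))] -/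
theorem yu_lemma9_3_engine {n p : ℕ} (hn : 1 ≤ n) (hp : p.Prime) (hp5 : 5 ≤ p)
    (α : Fin n → ℚ) (b : Fin n → ℤ) (hα : ∀ i, α i ≠ 0 ∧ padicValRat p (α i) = 0)
    (hind : ∀ e : Fin n → ℤ, ∏ i, α i ^ e i = 1 → e = 0) (hb : b ≠ 0)
    (δ : ℝ) {G B : ℝ} (hG : G ≤ yuG1Rat n) (hB5 : 5 ≤ B) (hBb : ∀ i, ((b i).natAbs : ℝ) ≤ B)
    (hv : (padicValRat p (∏ i, α i ^ b i - 1) : ℝ) <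
      stewartC n p δ * (∏ i, logHeight₁ (α i)) * max (Real.log (stewartB b)) G) :
    (padicValRat p (∏ i, α i ^ b i - 1) : ℝ) <
      ((n : ℝ) + 1) * stewartC n p δ * (∏ i, logHeight₁ (α i)) * Real.log B := by
  obtain ⟨m, rfl⟩ : ∃ m, n = m + 1 := ⟨n - 1, by omega⟩
  set v : ℝ := (padicValRat p (∏ i, α i ^ b i - 1) : ℝ) with hvdef
  set C := stewartC (m + 1) p δ with hCdef
  set H := ∏ i, logHeight₁ (α i) with hHdef
  set L := Real.log p with hLdef
  set E := (7 * Real.exp 1) ^ (m + 1) * Real.exp 1 ^ (m + 1) with hEdef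
  set P := ∏ j : Fin m, Real.log ((j : ℕ) + 2 : ℝ) with hPdef
  push_cast at hG ⊢
  have hp' : (5 : ℝ) ≤ p := by exact_mod_cast hp5
  have hm0 : (0 : ℝ) ≤ m := Nat.cast_nonneg m
  have hL : (1.6089 : ℝ) < L := log_gt_d4_of_five_le hp5
  have hL0 : 0 < L := by linarith
  have hB0 : 0 < B := by linarith
  have hlogB : (1.6089 : ℝ) < Real.log B :=
    lt_of_lt_of_le log_five_gt_d4 (Real.log_le_log (by norm_num) hB5)
  have hlogB0 : 0 < Real.log B := by linarith
  have hH0 : 0 ≤ H := Finset.prod_nonneg fun i _ => zero_le_logHeight₁ _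
  have he1 : (1 : ℝ) ≤ Real.exp 1 := by have := Real.add_one_le_exp (1 : ℝ); linarith
  have hE1 : 1 ≤ E :=
    one_le_mul_of_one_le_of_one_le (one_le_pow₀ (by nlinarith)) (one_le_pow₀ he1)
  have hE0 : 0 < E := by linarith
  have hP0 : 0 ≤ P := Finset.prod_nonneg fun j _ =>
    Real.log_nonneg (by have : (0:ℝ) ≤ ((j : ℕ) : ℝ) := Nat.cast_nonneg _; linarith)
  have hCge : 1504 * Real.sqrt ((m : ℝ) + 1 + 1) * E * L ≤ C := by
    have := stewartC_ge_sqrt (m + 1) hp5 δ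
    push_cast at this
    simpa only [hEdef, mul_assoc] using this
  have hC0 : 0 ≤ C := le_trans (by positivity) hCge
  have hBS : Real.log (stewartB b) ≤ Real.log B := by
    have h2 : (2 : ℝ) ≤ (stewartB b : ℝ) := by exact_mod_cast two_le_stewartB b
    exact Real.log_le_log (by linarith) (stewartB_le_of b (by linarith) hBb)
  by_cases hcase : G ≤ ((m : ℝ) + 1 + 1) * Real.log B
  · -- the trivial branch
    have hmax : max (Real.log (stewartB b)) G ≤ ((m : ℝ) + 1 + 1) * Real.log B :=
      max_le (by nlinarith) hcase
    calc v < C * H * max (Real.log (stewartB b)) G := hv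
      _ ≤ C * H * (((m : ℝ) + 1 + 1) * Real.log B) :=
          mul_le_mul_of_nonneg_left hmax (mul_nonneg hC0 hH0)
      _ = ((m : ℝ) + 1 + 1) * C * H * Real.log B := by ring
  · -- the Liouville branch: `B` is small
    set x := (2 + Real.log 7) * ((m : ℝ) + 1) + 5.84 with hxdef
    have h7 : (0 : ℝ) ≤ Real.log 7 := Real.log_nonneg (by norm_num)
    have h7' : Real.log 7 < 1.95 := log_seven_lt_d2
    have hx0 : 0 < x := by rw [hxdef]; nlinarith
    have hGle : G ≤ ((m : ℝ) + 1 + 1) * (x + Real.log x) := by rw [yuG1Rat_def] at hG; push_cast at hG; exact hG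
    have hlogBlt : Real.log B < x + Real.log x := by
      have h1 : ((m : ℝ) + 1 + 1) * Real.log B < ((m : ℝ) + 1 + 1) * (x + Real.log x) := by
        push Not at hcase
        linarith
      exact lt_of_mul_lt_mul_left h1 (by linarith)
    have hBlt : B < Real.exp x * x := by
      have := (Real.log_lt_iff_lt_exp hB0).mp hlogBlt
      rwa [Real.exp_add, Real.exp_log hx0] at this
    have hexpx : Real.exp x = E * Real.exp 5.84 := by
      rw [hxdef, Real.exp_add]
      congr 1
      rw [show (2 + Real.log 7) * ((m : ℝ) + 1) = ((m + 1 : ℕ) : ℝ) * (2 + Real.log 7) by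
        push_cast; ring, Real.exp_nat_mul, Real.exp_add, Real.exp_log (by norm_num : (0 : ℝ) < 7),
        show Real.exp 2 = Real.exp 1 ^ 2 by rw [← Real.exp_nat_mul]; norm_num, hEdef, ← mul_pow]
      congr 1
      ring
    have h584 : Real.exp 5.84 < 403.5 := lt_trans (Real.exp_lt_exp.mpr (by norm_num)) exp_six_lt
    have hxle : x ≤ 3.95 * ((m : ℝ) + 1) + 5.84 := by rw [hxdef]; nlinarith
    set W := 403.5 * E * (3.95 * ((m : ℝ) + 1) + 5.84) with hWdef
    have hBW : B ≤ W := by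
      calc B ≤ Real.exp x * x := hBlt.le
        _ = E * Real.exp 5.84 * x := by rw [hexpx]
        _ ≤ E * 403.5 * (3.95 * ((m : ℝ) + 1) + 5.84) :=
            mul_le_mul (mul_le_mul_of_nonneg_left h584.le hE0.le) hxle hx0.le (by positivity)
        _ = W := by rw [hWdef]; ring
    -- Liouville
    have hΞ : ∏ i, α i ^ b i ≠ 1 := fun h1 => hb (hind b h1)
    have hLiou := padicValRat_prod_zpow_sub_one_mul_log_le hp α b hΞ
    -- an index of maximal height
    obtain ⟨k, -, hk⟩ := Finset.exists_max_image univ (fun i => logHeight₁ (α i))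
      ⟨(0 : Fin (m + 1)), mem_univ _⟩
    set hK := logHeight₁ (α k) with hKdef
    have hk2 : Real.log 2 ≤ hK := by
      obtain ⟨h1, hm1⟩ := ne_one_and_ne_neg_one_of_multIndep hind k
      exact log_two_le_logHeight₁ (hα k).1 h1 hm1
    have hlog2 : (0.6931 : ℝ) < Real.log 2 := lt_trans (by norm_num) Real.log_two_gt_d9
    have hK0 : 0 < hK := by linarith
    have hsum : ∑ i, ((b i).natAbs : ℝ) * logHeight₁ (α i) ≤ B * (((m : ℝ) + 1) * hK) := by
      calc ∑ i, ((b i).natAbs : ℝ) * logHeight₁ (α i) ≤ ∑ _i : Fin (m + 1), B * hK :=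
            Finset.sum_le_sum fun i _ =>
              mul_le_mul (hBb i) (hk i (mem_univ i)) (zero_le_logHeight₁ _) hB0.le
        _ = B * (((m : ℝ) + 1) * hK) := by
            rw [Finset.sum_const, Finset.card_univ, Fintype.card_fin]; ring
    -- the other heights
    have hprod : hK * P ≤ H := by
      rw [hHdef, Fin.prod_univ_succAbove (fun i => logHeight₁ (α i)) k]
      exact mul_le_mul_of_nonneg_left
        (prod_log_le_prod_logHeight₁ (fun j => α (k.succAbove j)) (fun j => (hα _).1)
          (multIndep_succAbove hind k)) hK0.le
    -- upper bound for `v · L`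
    have hup : v * L ≤ hK * E * (403.5 * ((m : ℝ) + 1) * (3.95 * ((m : ℝ) + 1) + 5.84) + 1) := by
      have h1 : v * L ≤ Real.log 2 + B * (((m : ℝ) + 1) * hK) := le_trans hLiou (by linarith)
      have h2 : B * (((m : ℝ) + 1) * hK) ≤ W * (((m : ℝ) + 1) * hK) :=
        mul_le_mul_of_nonneg_right hBW (by positivity)
      have h3 : Real.log 2 ≤ hK * E := le_trans hk2 (le_mul_of_one_le_right hK0.le hE1)
      have hWeq : W * (((m : ℝ) + 1) * hK) =
          hK * E * (403.5 * ((m : ℝ) + 1) * (3.95 * ((m : ℝ) + 1) + 5.84)) := by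
        rw [hWdef]; ring
      calc v * L ≤ Real.log 2 + B * (((m : ℝ) + 1) * hK) := h1
        _ ≤ Real.log 2 + W * (((m : ℝ) + 1) * hK) := by linarith only [h2]
        _ = Real.log 2 + hK * E * (403.5 * ((m : ℝ) + 1) * (3.95 * ((m : ℝ) + 1) + 5.84)) := by
            rw [hWeq]
        _ ≤ hK * E + hK * E * (403.5 * ((m : ℝ) + 1) * (3.95 * ((m : ℝ) + 1) + 5.84)) := by
            linarith only [h3]
        _ = hK * E * (403.5 * ((m : ℝ) + 1) * (3.95 * ((m : ℝ) + 1) + 5.84) + 1) := by ring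
    -- the numerical inequality
    have hnum : 403.5 * ((m : ℝ) + 1) * (3.95 * ((m : ℝ) + 1) + 5.84) + 1 <
        6263.7 * ((m : ℝ) + 1 + 1) * Real.sqrt ((m : ℝ) + 1 + 1) * P := by
      have := yu93_numeric m
      rw [show ((m : ℝ) + 2) = (m : ℝ) + 1 + 1 by ring] at this
      calc 403.5 * ((m : ℝ) + 1) * (3.95 * ((m : ℝ) + 1) + 5.84) + 1
          = 403.5 * ((m : ℝ) + 1) * (3.95 * m + 9.79) + 1 := by ring
        _ < _ := this
    -- lower bound for the right side times `L`
    have hlow : 6263.7 * ((m : ℝ) + 1 + 1) * Real.sqrt ((m : ℝ) + 1 + 1) * P * (hK * E) ≤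
        ((m : ℝ) + 1 + 1) * C * H * Real.log B * L := by
      have hc : (6263.7 : ℝ) ≤ 1504 * (1.6089 ^ 2 * 1.6089) := by norm_num
      have hLL : (1.6089 : ℝ) ^ 2 * 1.6089 ≤ L ^ 2 * Real.log B :=
        mul_le_mul (pow_le_pow_left₀ (by norm_num) hL.le 2) hlogB.le (by norm_num) (by positivity)
      have hs0 : 0 ≤ Real.sqrt ((m : ℝ) + 1 + 1) := Real.sqrt_nonneg _
      calc 6263.7 * ((m : ℝ) + 1 + 1) * Real.sqrt ((m : ℝ) + 1 + 1) * P * (hK * E)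
          ≤ 1504 * (L ^ 2 * Real.log B) * ((m : ℝ) + 1 + 1) * Real.sqrt ((m : ℝ) + 1 + 1) * P *
              (hK * E) := by
            have h64 : (6263.7 : ℝ) ≤ 1504 * (L ^ 2 * Real.log B) :=
              le_trans hc (mul_le_mul_of_nonneg_left hLL (by norm_num))
            have hrest : 0 ≤ ((m : ℝ) + 1 + 1) * Real.sqrt ((m : ℝ) + 1 + 1) * P * (hK * E) := by
              positivity
            have := mul_le_mul_of_nonneg_right h64 hrest
            calc 6263.7 * ((m : ℝ) + 1 + 1) * Real.sqrt ((m : ℝ) + 1 + 1) * P * (hK * E)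
                = 6263.7 * (((m : ℝ) + 1 + 1) * Real.sqrt ((m : ℝ) + 1 + 1) * P * (hK * E)) := by
                  ring
              _ ≤ 1504 * (L ^ 2 * Real.log B) *
                    (((m : ℝ) + 1 + 1) * Real.sqrt ((m : ℝ) + 1 + 1) * P * (hK * E)) := this
              _ = _ := by ring
        _ = ((m : ℝ) + 1 + 1) * (1504 * Real.sqrt ((m : ℝ) + 1 + 1) * E * L) * (hK * P) *
              Real.log B * L := by ring
        _ ≤ ((m : ℝ) + 1 + 1) * C * H * Real.log B * L := by
            have h1 : ((m : ℝ) + 1 + 1) * (1504 * Real.sqrt ((m : ℝ) + 1 + 1) * E * L) ≤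
                ((m : ℝ) + 1 + 1) * C := mul_le_mul_of_nonneg_left hCge (by linarith)
            have h2 : ((m : ℝ) + 1 + 1) * (1504 * Real.sqrt ((m : ℝ) + 1 + 1) * E * L) * (hK * P) ≤
                ((m : ℝ) + 1 + 1) * C * H :=
              mul_le_mul h1 hprod (by positivity) (by positivity)
            exact mul_le_mul_of_nonneg_right (mul_le_mul_of_nonneg_right h2 hlogB0.le) hL0.le
    have hfin : v * L < ((m : ℝ) + 1 + 1) * C * H * Real.log B * L := by
      calc v * L ≤ hK * E * (403.5 * ((m : ℝ) + 1) * (3.95 * ((m : ℝ) + 1) + 5.84) + 1) := hup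
        _ < hK * E * (6263.7 * ((m : ℝ) + 1 + 1) * Real.sqrt ((m : ℝ) + 1 + 1) * P) :=
            mul_lt_mul_of_pos_left hnum (by positivity)
        _ = 6263.7 * ((m : ℝ) + 1 + 1) * Real.sqrt ((m : ℝ) + 1 + 1) * P * (hK * E) := by ring
        _ ≤ _ := hlow
    exact lt_of_mul_lt_mul_right hfin hL0.le


/-- **Yu's `C₄(n, d, ℘, a)` at `d = 1` is `(n+1)` times Stewart's `C`:**
`376 (n+1)^{3/2} (7e(p−1)/(p−2))ⁿ log(e⁴(n+1)) max{p δ⁻¹ (n/log p)ⁿ, eⁿ log p} = (n+1) · C`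
(`d^{n+2} log* d = 1`, `f_℘ = 1`). [cite: Yu2013, Lemma 9.3 (p. 378); Stewart2013, Lemma 3.1] -/
theorem yuC4Rat_eq (n p : ℕ) (δ : ℝ) :
    376 * ((n : ℝ) + 1) ^ ((3 : ℝ) / 2) * (7 * Real.exp 1 * (((p : ℝ) - 1) / ((p : ℝ) - 2))) ^ n *
        Real.log (Real.exp 4 * (n + 1)) *
        max ((p : ℝ) / δ * ((n : ℝ) / Real.log p) ^ n) (Real.exp n * Real.log p) =
      ((n : ℝ) + 1) * stewartC n p δ := by
  have hn0 : (0 : ℝ) < (n : ℝ) + 1 := by positivity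
  have h32 : ((n : ℝ) + 1) ^ ((3 : ℝ) / 2) = ((n : ℝ) + 1) * Real.sqrt ((n : ℝ) + 1) := by
    rw [show ((3 : ℝ) / 2) = 1 + (1 / 2 : ℝ) by norm_num, Real.rpow_add hn0, Real.rpow_one,
      Real.sqrt_eq_rpow]
  rw [h32, stewartC_def]
  ring

/-- **[Yu2013, Lemma 9.3] for `K = ℚ`, from the named fact `Stewart2013_lemma5_rat`** (proved
modulo that fact; for `n = 1` unconditionally, `yu2013_lemma9_3_rat_one`). K. Yu, *p-adic
logarithmic forms and a problem of Erdős*, Acta Math. 211 (2013), Lemma 9.3 (p. 378): let `K` be a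
number field, `d = [K : ℚ]`, `α₀` as in (1.4), `p ≥ 5` prime, `℘ ∣ p` with `e_℘ = 1` and residue
degree `f_℘`; let `α₁, …, αₙ` be multiplicatively independent `℘`-adic units in `K`, `b₁, …, bₙ`
rational integers not all zero, and `B` a real number with `B ≥ max{|b₁|, …, |bₙ|, 5}`. Then
`ord_℘(α₁^{b₁}⋯αₙ^{bₙ} − 1) < C₄(n,d,℘,a) h₀(α₁)⋯h₀(αₙ) log B`,
`C₄ = 376 (n+1)^{3/2} (7e(p−1)/(p−2))ⁿ d^{n+2} log*d · log(e⁴(n+1)d) · max{p^{f_℘} δ(a)⁻¹ (n/(f_℘ log p))ⁿ, eⁿ f_℘ log p}`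
("generally speaking, Lemma 9.3 is sharper than [25, Lemma 3.1]" = Stewart's Lemma 5: no
`max` with `G₁`, at the price of the factor `n + 1`). Here `K = ℚ`: `d = 1`, `℘ = p`,
`f_℘ = 1`, `h₀ = logHeight₁`, `C₄(n,1,p,a) = (n+1) · C` with Stewart's `C = stewartC n p δ`
(`yuC4Rat_eq`), and `δ(a)` is rendered — as in the named fact — by Stewart's
`δ = stewartDelta p α ≤ δ(a)` ((1.6)–(1.8); `C₄` is non-increasing in `δ`). The printed proof
(ibid.) applies Theorem 1 with `r = n`, i.e. Theorem I together with the Liouville dichotomy of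
Lemma 8.1 ((8.2)–(8.5), with Loher–Masser's lower bound for the product of the other heights),
then (9.14)–(9.15). Here, over `ℚ`: if `G₁^ℚ(n) ≤ (n+1) log B` the named fact gives the claim at
once; otherwise `B < e^{a₀ n + a₁}(a₀ n + a₁)` and the Liouville bound
(`padicValRat_prod_zpow_sub_one_mul_log_le`) is already smaller, the product of the other `n − 1`
heights of multiplicatively independent rationals being `≥ log 2 ⋯ log n`
(`prod_log_le_prod_logHeight₁`, an elementary substitute for Loher–Masser over `ℚ`) —
`yu_lemma9_3_engine`, `yu93_numeric`. NOT proved in the tree: the named fact for `n ≥ 2` (Yu's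
Theorem I over `ℚ`). [cite: Yu2013, Lemma 9.3 (K = ℚ), with Lemma 8.1 and Theorem 1 (1.24)]
[cite: Stewart2013, Lemma 3.1] -/
theorem Stewart2013_lemma5_rat.yu2013_lemma9_3 (h : Stewart2013_lemma5_rat) (n p : ℕ)
    (α : Fin n → ℚ) (b : Fin n → ℤ) (B : ℝ) (hn : 1 ≤ n) (hp : p.Prime) (hp5 : 5 ≤ p)
    (hα : ∀ i, α i ≠ 0 ∧ padicValRat p (α i) = 0)
    (hind : ∀ e : Fin n → ℤ, ∏ i, α i ^ e i = 1 → e = 0) (hb : b ≠ 0)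
    (hB5 : 5 ≤ B) (hBb : ∀ i, ((b i).natAbs : ℝ) ≤ B) :
    (padicValRat p (∏ i, α i ^ b i - 1) : ℝ) <
      ((n : ℝ) + 1) * stewartC n p (stewartDelta p α) * (∏ i, logHeight₁ (α i)) * Real.log B :=
  yu_lemma9_3_engine hn hp hp5 α b hα hind hb (stewartDelta p α) le_rfl hB5 hBb
    (h n p α b hp hp5 hα hind hb)

/-- **[Yu2013, Lemma 9.3] for `K = ℚ` and one logarithm (`n = 1`), unconditionally:**
`ord_p(α^{b} − 1) < 2 · C · h(α) · log B` for `B ≥ max(|b|, 5)` (`C = stewartC 1 p δ`), from the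
proved one-logarithm case of Stewart's Lemma 5 (`Stewart2013_lemma5_rat_of_le_one`, printed
form, `(n+1) · 5.4n = 10.8 ≤ G₁^ℚ(1)`) and `yu_lemma9_3_engine`.
[cite: Yu2013, Lemma 9.3 (K = ℚ, n = 1)] [cite: Stewart2013, Lemma 3.1] -/
theorem yu2013_lemma9_3_rat_one (p : ℕ) (α : Fin 1 → ℚ) (b : Fin 1 → ℤ) (B : ℝ)
    (hp : p.Prime) (hp5 : 5 ≤ p) (hα : ∀ i, α i ≠ 0 ∧ padicValRat p (α i) = 0)
    (hind : ∀ e : Fin 1 → ℤ, ∏ i, α i ^ e i = 1 → e = 0) (hb : b ≠ 0)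
    (hB5 : 5 ≤ B) (hBb : ∀ i, ((b i).natAbs : ℝ) ≤ B) :
    (padicValRat p (∏ i, α i ^ b i - 1) : ℝ) <
      (((1 : ℕ) : ℝ) + 1) * stewartC 1 p (stewartDelta p α) * (∏ i, logHeight₁ (α i)) *
        Real.log B := by
  have hv := Stewart2013_lemma5_rat_of_le_one 1 p le_rfl α b hp hp5 hα hind hb
  exact yu_lemma9_3_engine le_rfl hp hp5 α b hα hind hb (stewartDelta p α)
    (printed_le_yuG1Rat (by norm_num)) hB5 hBb hv

end Literature.NumberTheory.DiophantineGeometry.Dioph
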